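import Literature.NumberTheory.LFunctions.LiouvilleWalshBoxCriterion
import Literature.NumberTheory.LFunctions.LiouvilleWalshSmallWeight
import Literature.NumberTheory.LFunctions.MoebiusWalshTypeIEstimate
import Mathlib.Analysis.SpecialFunctions.Pow.Asymptotics
import HarnessLib

/-!
# Bourgain 2013, Theorem 1 for the Liouville function: the synthesis from per-box bounds — proved

Topic `Literature/NumberTheory/LFunctions`, proofs companion of `MoebiusWalshCircuits.lean`
(named fact `bourgain_liouville_walsh_uniform`: J. Bourgain, *Möbius–Walsh correlation bounds and
an estimate of Mauduit and Rivat*, J. Anal. Math. **119** (2013) 147–163 = arXiv:1109.2784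
[Bourgain2013MoebiusWalsh], Theorem 1 with the printed parenthesis "(a similar estimate is also
valid for the Liouville function)"). Everything here is PROVED (theorems only; no definition, no
named fact, nothing assumed beyond the explicit hypothesis `hII` of the last theorem).

## What is proved (namespace `Literature.NumberTheory.LFunctions.LiouvilleWalsh`)

The file carries out the "conclusion" of the paper (§2 (2.30)–(2.35) and §3 (3.1)–(3.10)) for
`λ`: it reduces Theorem 1 to ONE per-box statement, the type-II estimate of §2, in the shape

  `hII (c C) : ∀ T i j ρ K β, i ≤ j → 1 ≤ ρ → (K = 0 ∨ (i ≤ K + ρ ∧ 4ρ < K)) → K + ρ ≤ j → |β| ≤ 1 →`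
  `  ∑_{a ∈ D_i} |∑_{b ∈ D_j} β(b) w_T(ab)| ≤ (i+j+2)^C 2^{i+j} (2^{-cρ} + 2^{Cρ - c i} + 2^{Cρ - c |T ∩ [K, K+i)|})`

(`D_i = [2^i, 2^{i+1})`, `w_T = MoebiusWalshVaughan.natWalsh T`; this is (2.29)/(2.31) of the paper
for the box `M = 2^i ≤ N = 2^j`, lag `L = 2^ρ`, window `S' ⊇ T ∩ [K, K+i)` of the admissible
shift `K` — `K = 0` or `μ - ρ ≤ K ≤ ν - ρ` in the paper's notation —, with the three savings
`L^{-c}`, `L^C M^{-c}`, `L^C 2^{-c|S'|}` and polynomial losses `(i+j+2)^C` in place of the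
paper's unspecified constants), and proves

* `bourgain_liouville_walsh_uniform_of_typeII : (∃ c > 0, ∃ C ≥ 1, hII c C) → bourgain_liouville_walsh_uniform`.

The route is the paper's: small weights `|A| ≤ √n/H`, `H ≍ n^{1/10}`, by B. Green's estimate for
`λ` ((2.32); tree: `LiouvilleWalsh.liouville_smallWeight`, from the proved
`green_liouville_fourierWalsh_holds`), `A = ∅` by the prime number theorem for `λ` (as packaged in `liouville_smallWeight`); large weights
through the Vaughan-type reduction to dyadic boxes and the box criterion
(`LiouvilleWalsh.abs_walshSum_liouville_le_of_boxBounds`, the tree's form of [M-R] Lemma 1 as used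
in §3) with `u = 2^{n/4 - s₀}`, `s₀ = ⌈3E⌉`, `B = ⌈8(n+1)⁴2^E⌉`, `E = n^{1/10}`:
* type-II boxes (`boxII_bound`): both coefficients have modulus `≤ 1`, the short side is
  `≥ n/6`, and a dense ADMISSIBLE window exists by pigeonhole ((2.30):
  `exists_admissible_window_dense`, `exists_admissible_window` — every window `[y, y+m)` with
  `y ≤ l - ρ` is covered by the two admissible windows `[0,m) ∪ [m-ρ, 2m-ρ)` or is itself admissible);
* type-I boxes (`boxI_bound`, `i ≤ j`, divisor-bounded coefficient removed by Cauchy–Schwarz,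
  `abs_boxSum_typeI_of_F`): the crude regime (3.3) `typeI_crude_regime` when `2^i ≤ 2^{c₂w'/2}`
  (tree: `MoebiusWalsh.typeI_crude`), the refined regime (3.5)–(3.9) `typeI_refined_regime` when the
  top `2i+2` digits carry few elements of `T` (tree: `MoebiusWalsh.typeI_refined`), and otherwise
  ((2.35)/(3.4)) the box is a type-II sum with `β = 1` and a dense admissible window near the top
  (`exists_admissible_window_top`);
* the numerics (`final_numerics`, `walshSum_liouville_largeWeight`): every large box is
  `≤ 2ⁿ poly(n) 2^{-3E/2}`, and the six pieces of the criterion are each `≤ 2^{n-E}/8`; the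
  threshold `n₀` collects eight growth conditions, all instances of `log n = o(n^{1/10})`
  (`eventually_mul_rpow_le_two_rpow`, `eventually_mul_rpow_le_rpow`).

The discharge `bourgain_liouville_walsh_uniform_holds` is then `…_of_typeII` applied to the per-box
type-II theorem of §2 (van der Corput (2.2), digit truncation, Fourier expansion and the counting
(2.11)–(2.27); tree: `MoebiusWalsh.vdC_bilinear`, `MoebiusWalshCarry`, `MoebiusWalshTypeII.typeII_core_zero`,
`MoebiusWalsh.localisedWalsh`, …), which is not in this file.

## References

* J. Bourgain, J. Anal. Math. 119 (2013) 147–163; arXiv:1109.2784: Theorem 1 (remark on `λ`),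
  §2 (2.29)–(2.35), §3 (3.1)–(3.10). [Bourgain2013MoebiusWalsh]
* B. Green, *On (not) computing the Möbius function using bounded depth circuits*, Combin.
  Probab. Comput. 21 (2012) 942–951, Proposition 1 (for `λ`). [Green2012]
-/

noncomputable section

open Finset Real Filter
open scoped ArithmeticFunction.sigma

namespace Literature.NumberTheory.LFunctions.LiouvilleWalsh

/-! ### Growth lemmas in `E(n) = n^{1/10}` -/

/-- `log n ≤ ε n^{1/10}` eventually. [folklore] -/
theorem eventually_log_le_mul_rpow_tenth {ε : ℝ} (hε : 0 < ε) :
    ∀ᶠ n : ℕ in atTop, Real.log n ≤ ε * (n : ℝ) ^ ((1 : ℝ) / 10) := by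
  have h := (isLittleO_log_rpow_atTop (by norm_num : (0 : ℝ) < 1 / 10)).bound hε
  have h2 := (tendsto_natCast_atTop_atTop (R := ℝ)).eventually h
  filter_upwards [h2] with n hn
  calc Real.log n ≤ ‖Real.log (n : ℝ)‖ := le_norm_self _
    _ ≤ ε * ‖(n : ℝ) ^ ((1 : ℝ) / 10)‖ := hn
    _ = ε * (n : ℝ) ^ ((1 : ℝ) / 10) := by
        rw [Real.norm_eq_abs, abs_of_nonneg (by positivity)]

/-- `n^{1/10} → ∞` along the naturals. [folklore] -/
theorem tendsto_rpow_tenth_atTop :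
    Tendsto (fun n : ℕ => (n : ℝ) ^ ((1 : ℝ) / 10)) atTop atTop :=
  (tendsto_rpow_atTop (by norm_num)).comp tendsto_natCast_atTop_atTop

/-- Polynomial growth is eventually below `2^{ε n^{1/10}}`: `a n^r ≤ 2^{ε n^{1/10}}` for large `n`.
[folklore] -/
theorem eventually_mul_rpow_le_two_rpow (a : ℝ) {r ε : ℝ} (hr : 0 ≤ r) (hε : 0 < ε) :
    ∀ᶠ n : ℕ in atTop, a * (n : ℝ) ^ r ≤ (2 : ℝ) ^ (ε * (n : ℝ) ^ ((1 : ℝ) / 10)) := by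
  by_cases ha : a ≤ 0
  · refine Filter.Eventually.of_forall fun n => ?_
    have h1 : a * (n : ℝ) ^ r ≤ 0 := mul_nonpos_of_nonpos_of_nonneg ha (by positivity)
    exact h1.trans (by positivity)
  have ha : 0 < a := lt_of_not_ge ha
  have hε' : 0 < ε * Real.log 2 / (2 * (r + 1)) := by
    have := Real.log_pos one_lt_two
    positivity
  filter_upwards [eventually_log_le_mul_rpow_tenth hε',
    tendsto_rpow_tenth_atTop.eventually_ge_atTop (2 * Real.log a / (ε * Real.log 2)),
    eventually_ge_atTop 1] with n hlog hE hn1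
  have hn0 : (0 : ℝ) < n := by exact_mod_cast hn1
  have hlog2 : 0 < Real.log 2 := Real.log_pos one_lt_two
  set E : ℝ := (n : ℝ) ^ ((1 : ℝ) / 10) with hEdef
  rw [Real.rpow_def_of_pos two_pos, Real.rpow_def_of_pos hn0, ← Real.exp_log ha, ← Real.exp_add,
    Real.exp_le_exp]
  -- `log a + r log n ≤ ε E log 2`
  have h1 : r * Real.log n ≤ ε * Real.log 2 / 2 * E := by
    have := mul_le_mul_of_nonneg_left hlog hr
    calc r * Real.log n ≤ r * (ε * Real.log 2 / (2 * (r + 1)) * E) := this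
      _ = (r / (r + 1)) * (ε * Real.log 2 / 2 * E) := by field_simp
      _ ≤ 1 * (ε * Real.log 2 / 2 * E) := by
          refine mul_le_mul_of_nonneg_right ?_ (by positivity)
          rw [div_le_one (by linarith)]; linarith
      _ = ε * Real.log 2 / 2 * E := one_mul _
  have h2 : Real.log a ≤ ε * Real.log 2 / 2 * E := by
    have h3 : 2 * Real.log a / (ε * Real.log 2) * (ε * Real.log 2) ≤ E * (ε * Real.log 2) :=
      mul_le_mul_of_nonneg_right hE (by positivity)
    rw [div_mul_cancel₀ _ (by positivity)] at h3
    linarith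
  calc Real.log a + Real.log n * r = Real.log a + r * Real.log n := by ring
    _ ≤ ε * Real.log 2 / 2 * E + ε * Real.log 2 / 2 * E := add_le_add h2 h1
    _ = Real.log 2 * (ε * E) := by ring

/-- Between two powers: `a n^p ≤ n^q` eventually, for `p < q`. [folklore] -/
theorem eventually_mul_rpow_le_rpow (a : ℝ) {p q : ℝ} (hpq : p < q) :
    ∀ᶠ n : ℕ in atTop, a * (n : ℝ) ^ p ≤ (n : ℝ) ^ q := by
  have h := ((tendsto_rpow_atTop (sub_pos.2 hpq)).comp tendsto_natCast_atTop_atTop).eventually_ge_atTop a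
  filter_upwards [h, eventually_ge_atTop 1] with n hn hn1
  have hn0 : (0 : ℝ) < n := by exact_mod_cast hn1
  have hn' : a ≤ (n : ℝ) ^ (q - p) := hn
  calc a * (n : ℝ) ^ p ≤ (n : ℝ) ^ (q - p) * (n : ℝ) ^ p :=
        mul_le_mul_of_nonneg_right hn' (by positivity)
    _ = (n : ℝ) ^ q := by rw [← Real.rpow_add hn0]; ring_nf

/-! ### Windows of digits: pigeonhole and the admissible cover -/

/-- **Pigeonhole over windows**: if `S ⊆ [0, N)` and `0 < m`, some window `[qm, qm + m)`,
`q ≤ N/m`, carries at least `|S|/(N/m + 1)` elements of `S`. [folklore] -/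
theorem exists_window_card_ge (S : Finset ℕ) {N m : ℕ} (hm : 0 < m) (hS : ∀ s ∈ S, s < N) :
    ∃ q, q ≤ N / m ∧
      (S.card : ℝ) ≤ ((N / m + 1 : ℕ) : ℝ) * (S.filter fun s => q * m ≤ s ∧ s < q * m + m).card := by
  classical
  set Q := N / m + 1 with hQ
  set f : ℕ → ℕ := fun q => (S.filter fun s => q * m ≤ s ∧ s < q * m + m).card with hf
  -- the windows cover `S`
  have hcover : S.card ≤ ∑ q ∈ range Q, f q := by
    have h1 : S = (range Q).biUnion fun q => S.filter fun s => q * m ≤ s ∧ s < q * m + m := by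
      ext s
      simp only [Finset.mem_biUnion, Finset.mem_range, Finset.mem_filter]
      constructor
      · intro hs
        refine ⟨s / m, ?_, hs, ?_, ?_⟩
        · have := Nat.div_le_div_right (c := m) (hS s hs).le
          omega
        · exact Nat.div_mul_le_self s m
        · have := Nat.lt_div_mul_add hm (a := s) ; linarith [Nat.div_mul_le_self s m, Nat.mod_lt s hm, Nat.div_add_mod' s m]
      · rintro ⟨q, _, hs, _, _⟩; exact hs
    calc S.card = ((range Q).biUnion fun q => S.filter fun s => q * m ≤ s ∧ s < q * m + m).card := by
          rw [← h1]
      _ ≤ ∑ q ∈ range Q, f q := Finset.card_biUnion_le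
  -- some window is at least average
  obtain ⟨q, hq, hmax⟩ := Finset.exists_max_image (range Q) f ⟨0, by simp [hQ]⟩
  refine ⟨q, by rw [Finset.mem_range] at hq; omega, ?_⟩
  have h2 : ∑ q' ∈ range Q, f q' ≤ Q * f q := by
    calc ∑ q' ∈ range Q, f q' ≤ ∑ _q' ∈ range Q, f q := Finset.sum_le_sum fun q' hq' => hmax q' hq'
      _ = Q * f q := by rw [Finset.sum_const, Finset.card_range, smul_eq_mul]
  have h3 : S.card ≤ Q * f q := hcover.trans h2
  exact_mod_cast h3

/-- **The admissible cover.** For `5ρ < m ≤ l` and a window `[y₀, y₀ + m)` with `y₀ ≤ l - ρ` there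
is an ADMISSIBLE shift `K` (`K = 0`, or `m ≤ K + ρ` and `4ρ < K`; always `K + ρ ≤ l`) whose
window `[K, K + m)` carries at least half as many elements of `T`: indeed
`[y₀, y₀+m) ⊆ [0, m) ∪ [m-ρ, 2m-ρ)` if `y₀ ≤ m - ρ`, and `K = y₀` is admissible otherwise.
[cite: Bourgain2013MoebiusWalsh, §2 (2.30)] -/
theorem exists_admissible_window (T : Finset ℕ) {m l ρ y₀ : ℕ} (hρm : 5 * ρ < m) (hml : m ≤ l)
    (hy : y₀ + ρ ≤ l) :
    ∃ K, (K = 0 ∨ (m ≤ K + ρ ∧ 4 * ρ < K)) ∧ K + ρ ≤ l ∧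
      (T.filter fun t => y₀ ≤ t ∧ t < y₀ + m).card ≤
        2 * (T.filter fun t => K ≤ t ∧ t < K + m).card := by
  classical
  by_cases hy0 : y₀ ≤ m - ρ
  · -- cover by the windows at `0` and at `m - ρ`
    have hsub : (T.filter fun t => y₀ ≤ t ∧ t < y₀ + m) ⊆
        (T.filter fun t => 0 ≤ t ∧ t < 0 + m) ∪ (T.filter fun t => m - ρ ≤ t ∧ t < m - ρ + m) := by
      intro t ht
      simp only [Finset.mem_union, Finset.mem_filter] at ht ⊢
      by_cases htm : t < m
      · exact Or.inl ⟨ht.1, Nat.zero_le _, by simpa using htm⟩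
      · refine Or.inr ⟨ht.1, by omega, by omega⟩
    have hcard := (Finset.card_le_card hsub).trans (Finset.card_union_le _ _)
    by_cases hcmp : (T.filter fun t => m - ρ ≤ t ∧ t < m - ρ + m).card ≤
        (T.filter fun t => 0 ≤ t ∧ t < 0 + m).card
    · refine ⟨0, Or.inl rfl, by omega, ?_⟩
      omega
    · refine ⟨m - ρ, Or.inr ⟨by omega, by omega⟩, by omega, ?_⟩
      omega
  · refine ⟨y₀, Or.inr ⟨by omega, by omega⟩, hy, ?_⟩
    omega

/-- **Windows near the top of a box.** For `5ρ < i`, `ρ ≤ i ≤ j`, the digits of `T` in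
`[j - i, i + j + 2)` number at most `4 W + ρ + 2`, where `W` is the count in the best admissible
window: `[j-i, j)` and `[j-ρ, j-ρ+i)` are admissible windows up to the factor `2` of
`exists_admissible_window`, and `ρ + 2` digits remain on top. [cite: Bourgain2013MoebiusWalsh, §3 (3.4), (2.35)] -/
theorem exists_admissible_window_top (T : Finset ℕ) {i j ρ : ℕ} (hρi : 5 * ρ < i) (hij : i ≤ j) :
    ∃ K, (K = 0 ∨ (i ≤ K + ρ ∧ 4 * ρ < K)) ∧ K + ρ ≤ j ∧
      (T.filter fun t => j - i ≤ t ∧ t < i + j + 2).card ≤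
        4 * (T.filter fun t => K ≤ t ∧ t < K + i).card + (ρ + 2) := by
  classical
  obtain ⟨K₁, hK₁, hK₁j, h₁⟩ := exists_admissible_window T hρi hij (y₀ := j - i) (by omega)
  obtain ⟨K₂, hK₂, hK₂j, h₂⟩ := exists_admissible_window T hρi hij (y₀ := j - ρ) (by omega)
  have hsub : (T.filter fun t => j - i ≤ t ∧ t < i + j + 2) ⊆
      ((T.filter fun t => j - i ≤ t ∧ t < j - i + i) ∪ (T.filter fun t => j - ρ ≤ t ∧ t < j - ρ + i)) ∪
        Finset.Ico (j - ρ + i) (i + j + 2) := by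
    intro t ht
    simp only [Finset.mem_union, Finset.mem_filter, Finset.mem_Ico] at ht ⊢
    obtain ⟨htT, ht1, ht2⟩ := ht
    have h3 : (j - i ≤ t ∧ t < j - i + i) ∨ (j - ρ ≤ t ∧ t < j - ρ + i) ∨
        (j - ρ + i ≤ t ∧ t < i + j + 2) := by omega
    rcases h3 with h3 | h3 | h3
    · exact Or.inl (Or.inl ⟨htT, h3⟩)
    · exact Or.inl (Or.inr ⟨htT, h3⟩)
    · exact Or.inr h3
  have hc1 := Finset.card_le_card hsub
  have hc2 := Finset.card_union_le
    ((T.filter fun t => j - i ≤ t ∧ t < j - i + i) ∪ (T.filter fun t => j - ρ ≤ t ∧ t < j - ρ + i))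
    (Finset.Ico (j - ρ + i) (i + j + 2))
  have hc3 := Finset.card_union_le (T.filter fun t => j - i ≤ t ∧ t < j - i + i)
    (T.filter fun t => j - ρ ≤ t ∧ t < j - ρ + i)
  rw [Nat.card_Ico] at hc2
  by_cases hcmp : (T.filter fun t => K₂ ≤ t ∧ t < K₂ + i).card ≤
      (T.filter fun t => K₁ ≤ t ∧ t < K₁ + i).card
  · exact ⟨K₁, hK₁, hK₁j, by omega⟩
  · exact ⟨K₂, hK₂, hK₂j, by omega⟩

/-- **A dense digit set has a dense admissible window** (Bourgain 2013, (2.30)): if `S ⊆ [0, n)`,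
`n ≤ m + l + s₀`, `5ρ < m ≤ l`, `0 < m`, then some admissible `K` has
`|S| ≤ (n/m + 1)(2|S ∩ [K, K+m)| + s₀ + ρ)`. [cite: Bourgain2013MoebiusWalsh, §2 (2.30)] -/
theorem exists_admissible_window_dense (S : Finset ℕ) {n m l ρ s₀ : ℕ} (hS : ∀ s ∈ S, s < n)
    (hn : n ≤ m + l + s₀) (hρm : 5 * ρ < m) (hml : m ≤ l) :
    ∃ K, (K = 0 ∨ (m ≤ K + ρ ∧ 4 * ρ < K)) ∧ K + ρ ≤ l ∧
      (S.card : ℝ) ≤ ((n / m + 1 : ℕ) : ℝ) *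
        (2 * ((S.filter fun t => K ≤ t ∧ t < K + m).card : ℝ) + s₀ + ρ) := by
  classical
  have hm : 0 < m := by omega
  obtain ⟨q, hq, hcard⟩ := exists_window_card_ge S hm hS
  have hQ0 : (0 : ℝ) ≤ ((n / m + 1 : ℕ) : ℝ) := by positivity
  by_cases hy : q * m + ρ ≤ l
  · obtain ⟨K, hK, hKl, hW⟩ := exists_admissible_window S hρm hml hy
    refine ⟨K, hK, hKl, hcard.trans ?_⟩
    refine mul_le_mul_of_nonneg_left ?_ hQ0
    have : ((S.filter fun s => q * m ≤ s ∧ s < q * m + m).card : ℝ) ≤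
        2 * ((S.filter fun t => K ≤ t ∧ t < K + m).card : ℝ) := by exact_mod_cast hW
    have hρ0 : (0 : ℝ) ≤ ρ := Nat.cast_nonneg _
    have hs0 : (0 : ℝ) ≤ s₀ := Nat.cast_nonneg _
    linarith
  · -- the window sticks out at the top: use `K = l - ρ`
    have hy : l < q * m + ρ := lt_of_not_ge hy
    refine ⟨l - ρ, Or.inr ⟨by omega, by omega⟩, by omega, hcard.trans ?_⟩
    refine mul_le_mul_of_nonneg_left ?_ hQ0
    have hsub : (S.filter fun s => q * m ≤ s ∧ s < q * m + m) ⊆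
        (S.filter fun t => l - ρ ≤ t ∧ t < l - ρ + m) ∪ Finset.Ico (l - ρ + m) n := by
      intro t ht
      simp only [Finset.mem_union, Finset.mem_filter, Finset.mem_Ico] at ht ⊢
      obtain ⟨htS, ht1, ht2⟩ := ht
      have htn := hS t htS
      have h3 : (l - ρ ≤ t ∧ t < l - ρ + m) ∨ (l - ρ + m ≤ t ∧ t < n) := by omega
      rcases h3 with h3 | h3
      · exact Or.inl ⟨htS, h3⟩
      · exact Or.inr h3
    have h1 := (Finset.card_le_card hsub).trans (Finset.card_union_le _ _)
    rw [Nat.card_Ico] at h1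
    have h2 : ((S.filter fun s => q * m ≤ s ∧ s < q * m + m).card : ℝ) ≤
        ((S.filter fun t => l - ρ ≤ t ∧ t < l - ρ + m).card : ℝ) + ((n - (l - ρ + m) : ℕ) : ℝ) := by
      exact_mod_cast h1
    have h3 : ((n - (l - ρ + m) : ℕ) : ℝ) ≤ s₀ + ρ := by
      have : n - (l - ρ + m) ≤ s₀ + ρ := by omega
      exact_mod_cast this
    have h4 : (0 : ℝ) ≤ ((S.filter fun t => l - ρ ≤ t ∧ t < l - ρ + m).card : ℝ) := Nat.cast_nonneg _
    linarith

/-! ### Per-box estimates: consuming the type-II bound, and the two type-I regimes -/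

open Literature.NumberTheory.LFunctions.MoebiusWalshVaughan (natWalsh dyBlock mem_dyBlock boxSum
  abs_natWalsh_le typeIICoeffA abs_typeIICoeffA_le typeIICoeffA_eq_zero)
open Literature.NumberTheory.LFunctions.LiouvilleWalshVaughan (liouvTypeICoeff abs_liouvTypeICoeff_le
  liouvTypeICoeff_eq_zero liouvTypeIICoeffB abs_liouvTypeIICoeffB_le liouvTypeIICoeffB_eq_zero)
open Literature.NumberTheory.LFunctions.MoebiusWalsh (walshSupExponent walshSupExponent_pos
  walshCoeff typeI_crude typeI_refined boxSum_comm boxSum_eq_boxSum_filter)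

/-- `c₂ = log₂(27/16)/4 ≤ 1`. [folklore] -/
theorem walshSupExponent_le_one : walshSupExponent ≤ 1 := by
  unfold walshSupExponent
  have h : Real.logb 2 (27 / 16) ≤ Real.logb 2 2 :=
    Real.logb_le_logb_of_le one_lt_two (by norm_num) (by norm_num)
  rw [Real.logb_self_eq_one one_lt_two] at h
  linarith

/-- **Putting the absolute value on the short side.** For `|α| ≤ 1` and any bound `F` on
`∑_{a ∈ D_m} |∑_{b ∈ D_l} β(b) w_T(ab)|`, both `|boxSum T m l α β|` and `|boxSum T l m β α|` are
`≤ F` (`ab = ba`). [cite: Bourgain2013MoebiusWalsh, §2 (2.1)] -/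
theorem abs_boxSum_le_of_shortSide (T : Finset ℕ) (m l : ℕ) {α β : ℕ → ℝ} (hα : ∀ a, |α a| ≤ 1)
    {F : ℝ} (hF : ∑ a ∈ dyBlock m, |∑ b ∈ dyBlock l, β b * natWalsh T (a * b)| ≤ F) :
    |boxSum T m l α β| ≤ F ∧ |boxSum T l m β α| ≤ F := by
  have h1 : |boxSum T m l α β| ≤ F := by
    unfold boxSum
    calc |∑ a ∈ dyBlock m, ∑ b ∈ dyBlock l, α a * β b * natWalsh T (a * b)|
        ≤ ∑ a ∈ dyBlock m, |∑ b ∈ dyBlock l, α a * β b * natWalsh T (a * b)| :=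
          Finset.abs_sum_le_sum_abs _ _
      _ = ∑ a ∈ dyBlock m, |α a| * |∑ b ∈ dyBlock l, β b * natWalsh T (a * b)| := by
          refine Finset.sum_congr rfl fun a _ => ?_
          rw [← abs_mul, Finset.mul_sum]
          congr 1
          refine Finset.sum_congr rfl fun b _ => ?_
          ring
      _ ≤ ∑ a ∈ dyBlock m, 1 * |∑ b ∈ dyBlock l, β b * natWalsh T (a * b)| := by
          gcongr with a _
          exact hα a
      _ ≤ F := by simpa using hF
  refine ⟨h1, ?_⟩
  rw [← boxSum_comm]
  exact h1

/-- **The three savings of the type-II bound are each `≤ 2^{-X}`** once `X ≤ cρ`,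
`Cρ + X ≤ c m` and `Cρ + X ≤ c W`. [cite: Bourgain2013MoebiusWalsh, §2 (2.33)–(2.35)] -/
theorem three_savings_le {c C ρ m W X : ℝ} (h1 : X ≤ c * ρ) (h2 : C * ρ + X ≤ c * m)
    (h3 : C * ρ + X ≤ c * W) :
    (2 : ℝ) ^ (-(c * ρ)) + (2 : ℝ) ^ (C * ρ - c * m) + (2 : ℝ) ^ (C * ρ - c * W) ≤
      3 * (2 : ℝ) ^ (-X) := by
  have e1 : (2 : ℝ) ^ (-(c * ρ)) ≤ (2 : ℝ) ^ (-X) :=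
    Real.rpow_le_rpow_of_exponent_le one_le_two (by linarith)
  have e2 : (2 : ℝ) ^ (C * ρ - c * m) ≤ (2 : ℝ) ^ (-X) :=
    Real.rpow_le_rpow_of_exponent_le one_le_two (by linarith)
  have e3 : (2 : ℝ) ^ (C * ρ - c * W) ≤ (2 : ℝ) ^ (-X) :=
    Real.rpow_le_rpow_of_exponent_le one_le_two (by linarith)
  linarith

/-- **Type-I, crude regime** (Bourgain 2013, (3.2')–(3.3), "conclusive if `M < C^H`"): for
`T' ⊆ [0, Λ)`, `Λ = i + j + 2`, `w' = |T'|`, if `i ≤ c₂ w'/2` and `12(Λ+1) 2^{-c₂w'/2} ≤ 2^{-X}` then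
`∑_{a ∈ D_i} |∑_{b ∈ D_j} w_{T'}(ab)| ≤ 2^{i+j} 2^{-X}`. [cite: Bourgain2013MoebiusWalsh, §3 (3.3)] -/
theorem typeI_crude_regime (T' : Finset ℕ) {i j : ℕ} (hT' : ∀ t ∈ T', t < i + j + 2) {X : ℝ}
    (hcase : (i : ℝ) ≤ walshSupExponent * T'.card / 2)
    (hbig : 12 * ((i + j + 2 : ℕ) + 1 : ℝ) * (2 : ℝ) ^ (-(walshSupExponent * T'.card / 2)) ≤
      (2 : ℝ) ^ (-X)) :
    ∑ a ∈ dyBlock i, |∑ b ∈ dyBlock j, natWalsh T' (a * b)| ≤ 2 ^ (i + j) * (2 : ℝ) ^ (-X) := by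
  set Λ : ℕ := i + j + 2 with hΛ
  set c₂ : ℝ := walshSupExponent with hc₂
  set w' : ℝ := (T'.card : ℝ) with hw'
  have h := typeI_crude T' hT' i j
  have hlog : 1 + Real.log ((2 : ℝ) ^ Λ) ≤ Λ + 1 := by
    rw [Real.log_pow]
    have h2 : Real.log 2 ≤ 1 := by have := Real.log_two_lt_d9; linarith
    have : (Λ : ℝ) * Real.log 2 ≤ Λ := by
      have := mul_le_mul_of_nonneg_left h2 (Nat.cast_nonneg Λ); simpa using this
    linarith
  have hi2 : ((i : ℝ) + 1) ≤ (2 : ℝ) ^ i := by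
    have : (i + 1 : ℕ) ≤ 2 ^ i := Nat.succ_le_of_lt (Nat.lt_two_pow_self)
    exact_mod_cast this
  have h2Λ : (2 : ℝ) ^ Λ = 4 * 2 ^ (i + j) := by
    rw [hΛ, pow_add]; ring
  -- the bracket of `typeI_crude` is at most `6 (Λ+1) 2^i 2^{i+j}`
  have hbr : 2 * (2 : ℝ) ^ j * ((i + 1) * 2 ^ i) + 2 ^ i * (2 ^ Λ * (1 + Real.log (2 ^ Λ))) ≤
      6 * ((Λ : ℝ) + 1) * 2 ^ i * 2 ^ (i + j) := by
    have hΛ0 : (0 : ℝ) ≤ Λ := Nat.cast_nonneg _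
    have t1 : 2 * (2 : ℝ) ^ j * ((i + 1) * 2 ^ i) ≤ 2 * 2 ^ i * 2 ^ (i + j) := by
      rw [pow_add]
      have := mul_le_mul_of_nonneg_right hi2 (by positivity : (0 : ℝ) ≤ 2 * 2 ^ j * 2 ^ i)
      nlinarith [this]
    have t2 : (2 : ℝ) ^ i * (2 ^ Λ * (1 + Real.log (2 ^ Λ))) ≤ 4 * (Λ + 1) * 2 ^ i * 2 ^ (i + j) := by
      calc (2 : ℝ) ^ i * (2 ^ Λ * (1 + Real.log (2 ^ Λ))) ≤ 2 ^ i * (2 ^ Λ * (Λ + 1)) := by gcongr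
        _ = 4 * (Λ + 1) * 2 ^ i * 2 ^ (i + j) := by rw [h2Λ]; ring
    have t3 : 2 * (2 : ℝ) ^ i * 2 ^ (i + j) ≤ 2 * (Λ + 1) * 2 ^ i * 2 ^ (i + j) := by
      have hp : (0 : ℝ) ≤ 2 ^ i * 2 ^ (i + j) := by positivity
      nlinarith [hp, hΛ0]
    linarith [t1, t2, t3]
  -- `2^i 2^{-c₂ w'} ≤ 2^{-c₂ w'/2}`
  have hexp : (2 : ℝ) ^ i * (2 : ℝ) ^ (-(c₂ * w')) ≤ (2 : ℝ) ^ (-(c₂ * w' / 2)) := by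
    rw [← Real.rpow_natCast, ← Real.rpow_add two_pos]
    exact Real.rpow_le_rpow_of_exponent_le one_le_two (by linarith)
  have hpos : (0 : ℝ) ≤ 2 * (2 : ℝ) ^ (-(c₂ * w')) := by positivity
  calc ∑ a ∈ dyBlock i, |∑ b ∈ dyBlock j, natWalsh T' (a * b)|
      ≤ 2 * (2 : ℝ) ^ (-(c₂ * w')) *
          (2 * 2 ^ j * ((i + 1) * 2 ^ i) + 2 ^ i * (2 ^ Λ * (1 + Real.log (2 ^ Λ)))) := h
    _ ≤ 2 * (2 : ℝ) ^ (-(c₂ * w')) * (6 * ((Λ : ℝ) + 1) * 2 ^ i * 2 ^ (i + j)) :=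
        mul_le_mul_of_nonneg_left hbr hpos
    _ = 12 * ((Λ : ℝ) + 1) * (2 ^ i * (2 : ℝ) ^ (-(c₂ * w'))) * 2 ^ (i + j) := by ring
    _ ≤ 12 * ((Λ : ℝ) + 1) * (2 : ℝ) ^ (-(c₂ * w' / 2)) * 2 ^ (i + j) := by
        gcongr
    _ ≤ (2 : ℝ) ^ (-X) * 2 ^ (i + j) := by
        refine mul_le_mul_of_nonneg_right ?_ (by positivity)
        simpa [hΛ] using hbig
    _ = 2 ^ (i + j) * (2 : ℝ) ^ (-X) := mul_comm _ _

/-- **Type-I, refined regime** (Bourgain 2013, (3.5)–(3.9)): for `i ≤ j`, `T' ⊆ [0, Λ)`,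
`Λ = i + j + 2`, `w' = |T'|`, `T₂ = T' ∩ [j-i, Λ)`: if the top digits are few,
`|T₂| log₂(2Λ) ≤ c₂ w'/4`, and `12(Λ+1) 2^{-c₂ w'/2} ≤ 2^{-X}`, then
`∑_{a ∈ D_i} |∑_{b ∈ D_j} w_{T'}(ab)| ≤ 2^{i+j} 2^{-X}`. [cite: Bourgain2013MoebiusWalsh, §3 (3.9)] -/
theorem typeI_refined_regime (T' : Finset ℕ) {i j : ℕ} (hij : i ≤ j) (hT' : ∀ t ∈ T', t < i + j + 2)
    {X : ℝ}
    (hfew : ((T'.filter fun t => ¬ t < j - i).card : ℝ) * Real.logb 2 (2 * (i + j + 2 : ℕ)) ≤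
      walshSupExponent * T'.card / 4)
    (hbig : 12 * ((i + j + 2 : ℕ) + 1 : ℝ) * (2 : ℝ) ^ (-(walshSupExponent * T'.card / 2)) ≤
      (2 : ℝ) ^ (-X)) :
    ∑ a ∈ dyBlock i, |∑ b ∈ dyBlock j, natWalsh T' (a * b)| ≤ 2 ^ (i + j) * (2 : ℝ) ^ (-X) := by
  set Λ : ℕ := i + j + 2 with hΛ
  set c₂ : ℝ := walshSupExponent with hc₂
  set w' : ℝ := (T'.card : ℝ) with hw'
  set T₁ := T'.filter (· < j - i) with hT₁
  set T₂ := T'.filter fun t => ¬ t < j - i with hT₂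
  have hc₂0 : 0 < c₂ := walshSupExponent_pos
  have hc₂1 : c₂ ≤ 1 := walshSupExponent_le_one
  have h := typeI_refined T' hT' hij
  -- cardinalities
  have hcard : (T₁.card : ℝ) + T₂.card = w' := by
    have := Finset.card_filter_add_card_filter_not (s := T') (p := (· < j - i))
    rw [hw', ← this]; push_cast; rfl
  have hΛ1 : (1 : ℝ) ≤ Real.logb 2 (2 * Λ) := by
    have hΛ2 : (2 : ℝ) ≤ 2 * Λ := by
      have : (1 : ℝ) ≤ Λ := by rw [hΛ]; exact_mod_cast Nat.le_add_left 1 (i + j + 1)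
      linarith
    calc (1 : ℝ) = Real.logb 2 2 := (Real.logb_self_eq_one one_lt_two).symm
      _ ≤ Real.logb 2 (2 * Λ) := Real.logb_le_logb_of_le one_lt_two (by norm_num) hΛ2
  have hT₂0 : (0 : ℝ) ≤ T₂.card := Nat.cast_nonneg _
  have hT₂le : (T₂.card : ℝ) ≤ w' / 4 := by
    have h1 : (T₂.card : ℝ) * 1 ≤ T₂.card * Real.logb 2 (2 * Λ) :=
      mul_le_mul_of_nonneg_left hΛ1 hT₂0
    have h2 : c₂ * w' / 4 ≤ w' / 4 := by
      have hw0 : 0 ≤ w' := Nat.cast_nonneg _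
      nlinarith
    have h3 : (T₂.card : ℝ) * Real.logb 2 (2 * Λ) ≤ c₂ * w' / 4 := hfew
    linarith
  -- `(2Λ)^{|T₂|} ≤ 2^{c₂ w'/4}`
  have hpowT₂ : (2 * Λ : ℝ) ^ T₂.card ≤ (2 : ℝ) ^ (c₂ * w' / 4) := by
    have hΛpos : (0 : ℝ) < 2 * Λ := by
      have : (0 : ℝ) < Λ := by rw [hΛ]; positivity
      linarith
    have e1 : (2 * Λ : ℝ) ^ T₂.card = (2 : ℝ) ^ (Real.logb 2 (2 * Λ) * T₂.card) := by
      rw [Real.rpow_mul (by norm_num), Real.rpow_logb two_pos (by norm_num) hΛpos, Real.rpow_natCast]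
    rw [e1]
    refine Real.rpow_le_rpow_of_exponent_le one_le_two ?_
    have : Real.logb 2 (2 * Λ) * T₂.card = T₂.card * Real.logb 2 (2 * Λ) := mul_comm _ _
    rw [this]; exact hfew
  -- `2^{-c₂|T₁|} ≤ 2^{-3 c₂ w'/4}`
  have hpowT₁ : (2 : ℝ) ^ (-(c₂ * (T₁.card : ℝ))) ≤ (2 : ℝ) ^ (-(3 * c₂ * w' / 4)) := by
    refine Real.rpow_le_rpow_of_exponent_le one_le_two ?_
    have : (T₁.card : ℝ) = w' - T₂.card := by linarith
    rw [this]
    nlinarith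
  -- the bracket
  have hbr : (2 : ℝ) ^ j * (2 * ((i + 1) * 2 ^ i) + (1 + Real.log (2 ^ (j - i)))) ≤
      ((Λ : ℝ) + 1) * 2 ^ (i + j) := by
    have hlog : 1 + Real.log ((2 : ℝ) ^ (j - i)) ≤ 2 ^ i * (1 + ((j - i : ℕ) : ℝ)) := by
      rw [Real.log_pow]
      have h2 : Real.log 2 ≤ 1 := by have := Real.log_two_lt_d9; linarith
      have h3 : ((j - i : ℕ) : ℝ) * Real.log 2 ≤ (j - i : ℕ) := by
        have := mul_le_mul_of_nonneg_left h2 (Nat.cast_nonneg (j - i)); simpa using this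
      have h4 : (1 : ℝ) ≤ 2 ^ i := one_le_pow₀ one_le_two
      have h5 : (0 : ℝ) ≤ 1 + ((j - i : ℕ) : ℝ) := by positivity
      nlinarith
    have hji : ((j - i : ℕ) : ℝ) = j - i := by push_cast [Nat.cast_sub hij]; ring
    calc (2 : ℝ) ^ j * (2 * ((i + 1) * 2 ^ i) + (1 + Real.log (2 ^ (j - i))))
        ≤ 2 ^ j * (2 * ((i + 1) * 2 ^ i) + 2 ^ i * (1 + ((j - i : ℕ) : ℝ))) := by
          gcongr
      _ = (2 * (i + 1) + (1 + ((j - i : ℕ) : ℝ))) * 2 ^ (i + j) := by rw [pow_add]; ring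
      _ ≤ ((Λ : ℝ) + 1) * 2 ^ (i + j) := by
          refine mul_le_mul_of_nonneg_right ?_ (by positivity)
          rw [hji, hΛ]; push_cast; linarith
  have hpos : (0 : ℝ) ≤ 2 * (2 : ℝ) ^ (-(c₂ * (T₁.card : ℝ))) * (2 * Λ : ℝ) ^ T₂.card := by positivity
  calc ∑ a ∈ dyBlock i, |∑ b ∈ dyBlock j, natWalsh T' (a * b)|
      ≤ 2 * (2 : ℝ) ^ (-(c₂ * (T₁.card : ℝ))) * (2 * Λ : ℝ) ^ T₂.card *
          (2 ^ j * (2 * ((i + 1) * 2 ^ i) + (1 + Real.log (2 ^ (j - i))))) := h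
    _ ≤ 2 * (2 : ℝ) ^ (-(c₂ * (T₁.card : ℝ))) * (2 * Λ : ℝ) ^ T₂.card *
          (((Λ : ℝ) + 1) * 2 ^ (i + j)) := mul_le_mul_of_nonneg_left hbr hpos
    _ ≤ 2 * (2 : ℝ) ^ (-(3 * c₂ * w' / 4)) * (2 : ℝ) ^ (c₂ * w' / 4) *
          (((Λ : ℝ) + 1) * 2 ^ (i + j)) := by
        gcongr
    _ = 2 * ((Λ : ℝ) + 1) * (2 : ℝ) ^ (-(c₂ * w' / 2)) * 2 ^ (i + j) := by
        have e : (2 : ℝ) ^ (-(3 * c₂ * w' / 4)) * (2 : ℝ) ^ (c₂ * w' / 4) =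
            (2 : ℝ) ^ (-(c₂ * w' / 2)) := by
          rw [← Real.rpow_add two_pos]; ring_nf
        rw [mul_assoc (2 : ℝ) ((2 : ℝ) ^ (-(3 * c₂ * w' / 4))), e]; ring
    _ ≤ 12 * ((Λ : ℝ) + 1) * (2 : ℝ) ^ (-(c₂ * w' / 2)) * 2 ^ (i + j) := by
        gcongr
        norm_num
    _ ≤ (2 : ℝ) ^ (-X) * 2 ^ (i + j) := by
        refine mul_le_mul_of_nonneg_right ?_ (by positivity)
        simpa [hΛ] using hbig
    _ = 2 ^ (i + j) * (2 : ℝ) ^ (-X) := mul_comm _ _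

/-- **From `F ≤ 2^{i+j} G` to the type-I box sum** (Cauchy–Schwarz against `∑ τ² ≤ Z log³`,
`abs_boxSum_le_sqrt_of_divisorBounded`): `|boxSum T i j c 1| ≤ 2^{i+j} · 2(i+j+2)² · √G` for
`|c| ≤ τ`. [cite: Bourgain2013MoebiusWalsh, §3 (3.1)] -/
theorem abs_boxSum_typeI_of_F (T : Finset ℕ) (i j : ℕ) {c : ℕ → ℝ} (hc : ∀ a, |c a| ≤ (σ 0 a : ℝ))
    {G F : ℝ} (hG : 0 ≤ G) (hF : ∑ a ∈ dyBlock i, |∑ b ∈ dyBlock j, natWalsh T (a * b)| ≤ F)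
    (hFle : F ≤ 2 ^ (i + j) * G) :
    |boxSum T i j c (fun _ => 1)| ≤
      2 ^ (i + j) * (2 * ((i + j + 2 : ℕ) : ℝ) ^ 2) * Real.sqrt G := by
  set Λ : ℕ := i + j + 2 with hΛ
  have h := abs_boxSum_le_sqrt_of_divisorBounded T i j hc (hF.trans hFle)
  refine h.trans ?_
  have hlog : 1 + Real.log ((2 : ℝ) ^ (i + 1)) ≤ Λ := by
    rw [Real.log_pow]
    have h2 : Real.log 2 ≤ 1 := by have := Real.log_two_lt_d9; linarith
    have : ((i + 1 : ℕ) : ℝ) * Real.log 2 ≤ (i + 1 : ℕ) := by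
      have := mul_le_mul_of_nonneg_left h2 (Nat.cast_nonneg (i + 1)); simpa using this
    have h3 : ((i + 1 : ℕ) : ℝ) + 1 ≤ Λ := by rw [hΛ]; push_cast; linarith
    linarith
  have hlog0 : 0 ≤ 1 + Real.log ((2 : ℝ) ^ (i + 1)) := by
    have := Real.log_nonneg (one_le_pow₀ (M₀ := ℝ) one_le_two (n := i + 1)); linarith
  have hΛ1 : (1 : ℝ) ≤ Λ := by rw [hΛ]; exact_mod_cast Nat.le_add_left 1 (i + j + 1)
  rw [← Real.sqrt_mul (by positivity)]
  have htarget : 0 ≤ 2 ^ (i + j) * (2 * (Λ : ℝ) ^ 2) * Real.sqrt G := by positivity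
  rw [← Real.sqrt_sq htarget]
  refine Real.sqrt_le_sqrt ?_
  have hsq : (2 ^ (i + j) * (2 * (Λ : ℝ) ^ 2) * Real.sqrt G) ^ 2 =
      2 ^ (i + j) * 2 ^ (i + j) * (4 * (Λ : ℝ) ^ 4) * G := by
    rw [mul_pow, mul_pow, Real.sq_sqrt hG]; ring
  rw [hsq]
  have hl3 : (1 + Real.log ((2 : ℝ) ^ (i + 1))) ^ 3 ≤ (Λ : ℝ) ^ 3 :=
    pow_le_pow_left₀ hlog0 hlog 3
  calc 2 ^ (i + 1) * (1 + Real.log (2 ^ (i + 1))) ^ 3 * (2 ^ j * (2 ^ (i + j) * G))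
      ≤ 2 ^ (i + 1) * (Λ : ℝ) ^ 3 * (2 ^ j * (2 ^ (i + j) * G)) := by gcongr
    _ = 2 ^ (i + j) * 2 ^ (i + j) * (2 * (Λ : ℝ) ^ 3) * G := by
        rw [pow_add, pow_add, pow_one]; ring
    _ ≤ 2 ^ (i + j) * 2 ^ (i + j) * (4 * (Λ : ℝ) ^ 4) * G := by
        have h34 : 2 * (Λ : ℝ) ^ 3 ≤ 4 * (Λ : ℝ) ^ 4 := by
          have h3 : (0 : ℝ) ≤ (Λ : ℝ) ^ 3 := by positivity
          nlinarith [mul_le_mul_of_nonneg_left hΛ1 h3]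
        have hp : (0 : ℝ) ≤ 2 ^ (i + j) * 2 ^ (i + j) := by positivity
        exact mul_le_mul_of_nonneg_right (mul_le_mul_of_nonneg_left h34 hp) hG

/-! ### The two kinds of large boxes, under the per-box type-II bound -/

/-- **Type-II boxes** (both coefficients of modulus `≤ 1`, short side `≥ i_u > n/6`): the
window of (2.30) comes from `exists_admissible_window_dense`, and the three savings of the per-box
type-II bound are each `≤ 2^{-3E}`. Here `P = A₀E`, `Q = E/c` with `A₀ = (3C/c + C + 3)/c`, so
that `Cρ + 3E ≤ cP`. [cite: Bourgain2013MoebiusWalsh, §2 (2.30)–(2.35)] -/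
theorem boxII_bound {c C : ℝ} (hc : 0 < c) (hC : 1 ≤ C)
    (hII : ∀ (T : Finset ℕ) (i j ρ K : ℕ) (β : ℕ → ℝ), i ≤ j → 1 ≤ ρ →
        (K = 0 ∨ (i ≤ K + ρ ∧ 4 * ρ < K)) → K + ρ ≤ j → (∀ b, |β b| ≤ 1) →
        ∑ a ∈ dyBlock i, |∑ b ∈ dyBlock j, β b * natWalsh T (a * b)| ≤
          ((i : ℝ) + j + 2) ^ C * 2 ^ (i + j) *
            ((2 : ℝ) ^ (-(c * ρ)) + (2 : ℝ) ^ (C * ρ - c * i) +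
              (2 : ℝ) ^ (C * ρ - c * ((T.filter fun t => K ≤ t ∧ t < K + i).card : ℝ))))
    {n m l s₀ ρ iu : ℕ} {E : ℝ} (hE : 1 ≤ E)
    (hρ1 : 1 ≤ ρ) (hρE : (ρ : ℝ) ≤ 3 * (E / c) + E) (hcρ : 3 * E ≤ c * ρ) (hs₀E : (s₀ : ℝ) ≤ 4 * E)
    (S T : Finset ℕ) (hS : ∀ s ∈ S, s < n) (hST : S ⊆ T)
    (hml : m ≤ l) (hmln : m + l < n) (hn : n ≤ m + l + s₀) (hm : iu ≤ m) (hiu : n < 6 * iu)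
    (hmE : (3 * C / c + C + 3) / c * E + 15 * (E / c) + 5 * E ≤ (n : ℝ) / 6)
    (hw : 12 * ((3 * C / c + C + 3) / c * E) + 18 * (E / c) + 30 * E ≤ S.card)
    (β : ℕ → ℝ) (hβ : ∀ b, |β b| ≤ 1) :
    ∑ a ∈ dyBlock m, |∑ b ∈ dyBlock l, β b * natWalsh T (a * b)| ≤
      ((n : ℝ) + 1) ^ C * 2 ^ n * (3 * (2 : ℝ) ^ (-(3 * E))) := by
  classical
  set P : ℝ := (3 * C / c + C + 3) / c * E with hP
  set Q : ℝ := E / c with hQ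
  have hC0 : 0 ≤ C := by linarith
  have hE0 : 0 ≤ E := by linarith
  have hQ0 : 0 ≤ Q := by rw [hQ]; positivity
  have hP0 : 0 ≤ P := by rw [hP]; positivity
  -- `Cρ + 3E ≤ c P`
  have hkey : C * ρ + 3 * E ≤ c * P := by
    have h1 : C * (ρ : ℝ) ≤ C * (3 * Q + E) := mul_le_mul_of_nonneg_left hρE hC0
    have h2 : c * P = 3 * C * Q + C * E + 3 * E := by
      rw [hP, hQ]; field_simp
    have h3 : C * (3 * Q + E) = 3 * C * Q + C * E := by ring
    linarith only [h1, h2, h3]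
  -- the short side is long enough
  have hm0 : 0 < m := by omega
  have hmreal : (n : ℝ) / 6 < m := by
    have h1 : (n : ℝ) < 6 * (iu : ℝ) := by exact_mod_cast hiu
    have h2 : (iu : ℝ) ≤ m := by exact_mod_cast hm
    linarith
  have h5ρ : 5 * ρ < m := by
    have h3 : ((5 * ρ : ℕ) : ℝ) < m := by push_cast; linarith only [hρE, hmE, hmreal, hP0]
    exact_mod_cast h3
  have hmP : P ≤ m := by linarith only [hmE, hmreal, hQ0, hE0]
  -- the window
  obtain ⟨K, hK, hKl, hwin⟩ := exists_admissible_window_dense S hS hn h5ρ hml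
  have hdiv : ((n / m + 1 : ℕ) : ℝ) ≤ 6 := by
    have : n / m < 6 := (Nat.div_lt_iff_lt_mul hm0).2 (by omega)
    have : n / m + 1 ≤ 6 := this
    exact_mod_cast this
  set WS : ℝ := ((S.filter fun t => K ≤ t ∧ t < K + m).card : ℝ) with hWS
  set WT : ℝ := ((T.filter fun t => K ≤ t ∧ t < K + m).card : ℝ) with hWT
  have hWST : WS ≤ WT := by
    rw [hWS, hWT]
    exact_mod_cast Finset.card_le_card (Finset.filter_subset_filter _ hST)
  have hWS0 : 0 ≤ WS := Nat.cast_nonneg _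
  have hw6 : (S.card : ℝ) ≤ 6 * (2 * WS + s₀ + ρ) := by
    refine hwin.trans ?_
    have : 0 ≤ 2 * WS + s₀ + ρ := by positivity
    exact mul_le_mul_of_nonneg_right hdiv this
  have hWP : P ≤ WT := by linarith only [hw6, hw, hWST, hs₀E, hρE]
  -- the per-box bound and its three savings
  have hF := hII T m l ρ K β hml hρ1 hK hKl hβ
  have hcm : c * P ≤ c * m := mul_le_mul_of_nonneg_left hmP hc.le
  have hcW : c * P ≤ c * WT := mul_le_mul_of_nonneg_left hWP hc.le
  have h3 := three_savings_le (c := c) (C := C) (ρ := ρ) (m := m) (W := WT) (X := 3 * E) hcρ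
    (by linarith only [hkey, hcm]) (by linarith only [hkey, hcW])
  refine hF.trans ?_
  have hpoly : ((m : ℝ) + l + 2) ^ C ≤ ((n : ℝ) + 1) ^ C := by
    refine Real.rpow_le_rpow (by positivity) ?_ hC0
    have : ((m + l + 1 : ℕ) : ℝ) ≤ n := by exact_mod_cast hmln
    push_cast at this; linarith
  have hpow : (2 : ℝ) ^ (m + l) ≤ 2 ^ n := pow_le_pow_right₀ one_le_two hmln.le
  calc ((m : ℝ) + l + 2) ^ C * 2 ^ (m + l) *
        ((2 : ℝ) ^ (-(c * ρ)) + (2 : ℝ) ^ (C * ρ - c * m) + (2 : ℝ) ^ (C * ρ - c * WT))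
      ≤ ((n : ℝ) + 1) ^ C * 2 ^ n * (3 * (2 : ℝ) ^ (-(3 * E))) := by
        gcongr

/-- **Type-I boxes** (`i ≤ j`, divisor-bounded coefficient on the short side): the crude regime
(3.3) when `i ≤ c₂ w'/2`, the refined regime (3.9) when the top digits are few, and otherwise
the box is a type-II sum with `β = 1` and a window near the top ((2.35), (3.4)); in all cases
`|boxSum T i j c 1| ≤ 2ⁿ · 4(n+1)^{2+C/2} · 2^{-3E/2}`. Here `P = A₀E`, `Q = E/c` as in
`boxII_bound` and `c₂ = walshSupExponent`. [cite: Bourgain2013MoebiusWalsh, §3 (3.1)–(3.9)] -/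
theorem boxI_bound {c C : ℝ} (hc : 0 < c) (hC : 1 ≤ C)
    (hII : ∀ (T : Finset ℕ) (i j ρ K : ℕ) (β : ℕ → ℝ), i ≤ j → 1 ≤ ρ →
        (K = 0 ∨ (i ≤ K + ρ ∧ 4 * ρ < K)) → K + ρ ≤ j → (∀ b, |β b| ≤ 1) →
        ∑ a ∈ dyBlock i, |∑ b ∈ dyBlock j, β b * natWalsh T (a * b)| ≤
          ((i : ℝ) + j + 2) ^ C * 2 ^ (i + j) *
            ((2 : ℝ) ^ (-(c * ρ)) + (2 : ℝ) ^ (C * ρ - c * i) +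
              (2 : ℝ) ^ (C * ρ - c * ((T.filter fun t => K ≤ t ∧ t < K + i).card : ℝ))))
    {n i j s₀ ρ : ℕ} {E : ℝ} (hE : 1 ≤ E) (hn1 : 1 ≤ n)
    (hρ1 : 1 ≤ ρ) (hρE : (ρ : ℝ) ≤ 3 * (E / c) + E) (hcρ : 3 * E ≤ c * ρ)
    (hlogE : Real.logb 2 (8 * n) ≤ E) (h2E : 12 * ((n : ℝ) + 3) ≤ (2 : ℝ) ^ E)
    (S T : Finset ℕ) (hS : ∀ s ∈ S, s < n) (hST : S ⊆ T)
    (hij : i ≤ j) (hijn : i + j < n) (hn : n ≤ i + j + s₀)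
    (hw1 : 8 * E ≤ walshSupExponent * ((S.card : ℝ) - s₀))
    (hw2 : (16 * ((3 * C / c + C + 3) / c * E) + 12 * (E / c) + 16 * E) * E ≤
      walshSupExponent * ((S.card : ℝ) - s₀))
    (hw3 : 2 * ((3 * C / c + C + 3) / c * E) + 30 * (E / c) + 10 * E ≤
      walshSupExponent * ((S.card : ℝ) - s₀))
    {cf : ℕ → ℝ} (hcf : ∀ a, |cf a| ≤ (σ 0 a : ℝ)) :
    |boxSum T i j cf (fun _ => 1)| ≤
      2 ^ n * (4 * ((n : ℝ) + 1) ^ (2 + C / 2)) * (2 : ℝ) ^ (-(3 * E) / 2) := by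
  classical
  set P : ℝ := (3 * C / c + C + 3) / c * E with hP
  set Q : ℝ := E / c with hQ
  set c₂ : ℝ := walshSupExponent with hc₂
  have hc₂0 : 0 < c₂ := walshSupExponent_pos
  have hc₂1 : c₂ ≤ 1 := walshSupExponent_le_one
  have hC0 : 0 ≤ C := by linarith
  have hE0 : 0 ≤ E := by linarith
  have hQ0 : 0 ≤ Q := by rw [hQ]; positivity
  have hP0 : 0 ≤ P := by rw [hP]; positivity
  have hkey : C * ρ + 3 * E ≤ c * P := by
    have h1 : C * (ρ : ℝ) ≤ C * (3 * Q + E) := mul_le_mul_of_nonneg_left hρE hC0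
    have h2 : c * P = 3 * C * Q + C * E + 3 * E := by
      rw [hP, hQ]; field_simp
    have h3 : C * (3 * Q + E) = 3 * C * Q + C * E := by ring
    linarith only [h1, h2, h3]
  -- the box only sees digits `< Λ = i + j + 2`
  set Λ : ℕ := i + j + 2 with hΛ
  set T' : Finset ℕ := T.filter (· < Λ) with hT'def
  have hT' : ∀ t ∈ T', t < i + j + 2 := fun t ht => (Finset.mem_filter.1 ht).2
  rw [boxSum_eq_boxSum_filter T (le_refl (i + j + 2))]
  have hΛn : (Λ : ℝ) ≤ n + 1 := by
    have : Λ ≤ n + 1 := by omega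
    exact_mod_cast this
  have hΛ1 : (1 : ℝ) ≤ Λ := by rw [hΛ]; exact_mod_cast Nat.le_add_left 1 (i + j + 1)
  -- `w' ≥ w - s₀`
  set w' : ℝ := (T'.card : ℝ) with hw'
  have hw' : (S.card : ℝ) - s₀ ≤ w' := by
    have h1 : (S.filter (· < Λ)).card + (S.filter fun t => ¬ t < Λ).card = S.card :=
      Finset.card_filter_add_card_filter_not (s := S) (p := (· < Λ))
    have h2 : (S.filter (· < Λ)).card ≤ T'.card :=
      Finset.card_le_card (Finset.filter_subset_filter _ hST)
    have h3 : (S.filter fun t => ¬ t < Λ).card ≤ s₀ := by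
      have hsub : (S.filter fun t => ¬ t < Λ) ⊆ Finset.Ico Λ n := by
        intro t ht
        rw [Finset.mem_filter] at ht
        rw [Finset.mem_Ico]
        exact ⟨not_lt.1 ht.2, hS t ht.1⟩
      have := Finset.card_le_card hsub
      rw [Nat.card_Ico] at this
      omega
    have h4 : S.card ≤ T'.card + s₀ := by omega
    have : ((S.card : ℕ) : ℝ) ≤ ((T'.card + s₀ : ℕ) : ℝ) := by exact_mod_cast h4
    push_cast at this
    linarith only [this]
  have hcw : c₂ * ((S.card : ℝ) - s₀) ≤ c₂ * w' := mul_le_mul_of_nonneg_left hw' hc₂0.le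
  -- `c₂ w'/2 ≥ 4E`, hence `12(Λ+1) 2^{-c₂w'/2} ≤ 2^{-3E}`
  have hc₂w' : 4 * E ≤ c₂ * w' / 2 := by linarith only [hw1, hcw]
  have hbig : 12 * ((i + j + 2 : ℕ) + 1 : ℝ) * (2 : ℝ) ^ (-(c₂ * w' / 2)) ≤
      (2 : ℝ) ^ (-(3 * E)) := by
    have h1 : 12 * ((i + j + 2 : ℕ) + 1 : ℝ) ≤ (2 : ℝ) ^ E := by
      have : ((i + j + 2 : ℕ) : ℝ) ≤ n + 1 := hΛn
      linarith only [this, h2E]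
    have h2 : (2 : ℝ) ^ (-(c₂ * w' / 2)) ≤ (2 : ℝ) ^ (-(3 * E) - E) :=
      Real.rpow_le_rpow_of_exponent_le one_le_two (by linarith only [hc₂w'])
    calc 12 * ((i + j + 2 : ℕ) + 1 : ℝ) * (2 : ℝ) ^ (-(c₂ * w' / 2))
        ≤ (2 : ℝ) ^ E * (2 : ℝ) ^ (-(3 * E) - E) :=
          mul_le_mul h1 h2 (by positivity) (by positivity)
      _ = (2 : ℝ) ^ (-(3 * E)) := by rw [← Real.rpow_add two_pos]; ring_nf
  -- the common final step
  have hfinal : ∀ G : ℝ, 0 ≤ G → G ≤ 4 * (Λ : ℝ) ^ C * (2 : ℝ) ^ (-(3 * E)) →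
      ∑ a ∈ dyBlock i, |∑ b ∈ dyBlock j, natWalsh T' (a * b)| ≤ 2 ^ (i + j) * G →
      |boxSum T' i j cf (fun _ => 1)| ≤
        2 ^ n * (4 * ((n : ℝ) + 1) ^ (2 + C / 2)) * (2 : ℝ) ^ (-(3 * E) / 2) := by
    intro G hG0 hGle hFG
    have h := abs_boxSum_typeI_of_F T' i j hcf hG0 hFG le_rfl
    refine h.trans ?_
    have hsqrt : Real.sqrt G ≤ 2 * (Λ : ℝ) ^ (C / 2) * (2 : ℝ) ^ (-(3 * E) / 2) := by
      have htarget : 0 ≤ 2 * (Λ : ℝ) ^ (C / 2) * (2 : ℝ) ^ (-(3 * E) / 2) := by positivity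
      rw [← Real.sqrt_sq htarget]
      refine Real.sqrt_le_sqrt (hGle.trans (le_of_eq ?_))
      have e1 : ((Λ : ℝ) ^ (C / 2)) ^ 2 = (Λ : ℝ) ^ C := by
        rw [← Real.rpow_natCast, ← Real.rpow_mul (by positivity)]; norm_num
      have e2 : ((2 : ℝ) ^ (-(3 * E) / 2)) ^ 2 = (2 : ℝ) ^ (-(3 * E)) := by
        rw [← Real.rpow_natCast, ← Real.rpow_mul (by norm_num)]; norm_num
      rw [mul_pow, mul_pow, e1, e2]; ring
    have hΛC : (2 * ((i + j + 2 : ℕ) : ℝ) ^ 2) * (2 * (Λ : ℝ) ^ (C / 2)) ≤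
        4 * ((n : ℝ) + 1) ^ (2 + C / 2) := by
      have e : ((Λ : ℝ)) ^ 2 * (Λ : ℝ) ^ (C / 2) = (Λ : ℝ) ^ (2 + C / 2) := by
        rw [← Real.rpow_natCast, ← Real.rpow_add (by positivity)]; norm_num
      have hmono : (Λ : ℝ) ^ (2 + C / 2) ≤ ((n : ℝ) + 1) ^ (2 + C / 2) :=
        Real.rpow_le_rpow (by positivity) hΛn (by positivity)
      calc (2 * ((i + j + 2 : ℕ) : ℝ) ^ 2) * (2 * (Λ : ℝ) ^ (C / 2))
          = 4 * (((Λ : ℝ)) ^ 2 * (Λ : ℝ) ^ (C / 2)) := by rw [hΛ]; ring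
        _ ≤ 4 * ((n : ℝ) + 1) ^ (2 + C / 2) := by rw [e]; linarith only [hmono]
    have hpow : (2 : ℝ) ^ (i + j) ≤ 2 ^ n := pow_le_pow_right₀ one_le_two hijn.le
    calc 2 ^ (i + j) * (2 * ((i + j + 2 : ℕ) : ℝ) ^ 2) * Real.sqrt G
        ≤ 2 ^ n * (2 * ((i + j + 2 : ℕ) : ℝ) ^ 2) * (2 * (Λ : ℝ) ^ (C / 2) * (2 : ℝ) ^ (-(3 * E) / 2)) := by
          gcongr
      _ = 2 ^ n * ((2 * ((i + j + 2 : ℕ) : ℝ) ^ 2) * (2 * (Λ : ℝ) ^ (C / 2))) *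
            (2 : ℝ) ^ (-(3 * E) / 2) := by ring
      _ ≤ 2 ^ n * (4 * ((n : ℝ) + 1) ^ (2 + C / 2)) * (2 : ℝ) ^ (-(3 * E) / 2) := by
          gcongr
  have hΛC1 : (1 : ℝ) ≤ (Λ : ℝ) ^ C := Real.one_le_rpow hΛ1 hC0
  have h2X0 : 0 ≤ (2 : ℝ) ^ (-(3 * E)) := by positivity
  have hsmallG : (2 : ℝ) ^ (-(3 * E)) ≤ 4 * (Λ : ℝ) ^ C * (2 : ℝ) ^ (-(3 * E)) := by
    have : (1 : ℝ) * (2 : ℝ) ^ (-(3 * E)) ≤ (4 * (Λ : ℝ) ^ C) * (2 : ℝ) ^ (-(3 * E)) :=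
      mul_le_mul_of_nonneg_right (by linarith only [hΛC1]) h2X0
    linarith only [this]
  -- case analysis
  by_cases hcase : (i : ℝ) ≤ c₂ * w' / 2
  · -- (a) the crude regime
    have hF := typeI_crude_regime T' hT' (X := 3 * E) hcase hbig
    exact hfinal ((2 : ℝ) ^ (-(3 * E))) h2X0 hsmallG hF
  · have hcase' : c₂ * w' / 2 < i := lt_of_not_ge hcase
    by_cases hfew : ((T'.filter fun t => ¬ t < j - i).card : ℝ) * Real.logb 2 (2 * (i + j + 2 : ℕ)) ≤
        c₂ * T'.card / 4
    · -- (b1) the refined regime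
      have hF := typeI_refined_regime T' hij hT' (X := 3 * E) hfew hbig
      exact hfinal ((2 : ℝ) ^ (-(3 * E))) h2X0 hsmallG hF
    · -- (b2) many top digits: a type-II sum with `β = 1`
      have hfew' : c₂ * w' / 4 <
          ((T'.filter fun t => ¬ t < j - i).card : ℝ) * Real.logb 2 (2 * (i + j + 2 : ℕ)) :=
        lt_of_not_ge hfew
      -- `i` is large: `i > c₂ w'/2 ≥ P + 15 Q + 5 E`
      have hiP : P + 15 * Q + 5 * E < i := by linarith only [hw3, hcw, hcase']
      have h5ρ : 5 * ρ < i := by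
        have h3 : ((5 * ρ : ℕ) : ℝ) < i := by push_cast; linarith only [hρE, hiP, hP0]
        exact_mod_cast h3
      obtain ⟨K, hK, hKj, hcov⟩ := exists_admissible_window_top T' h5ρ hij
      set W : ℝ := ((T'.filter fun t => K ≤ t ∧ t < K + i).card : ℝ) with hW
      -- the top digits are many, so the window is dense
      have hlogΛ : Real.logb 2 (2 * (i + j + 2 : ℕ)) ≤ E := by
        refine le_trans ?_ hlogE
        refine Real.logb_le_logb_of_le one_lt_two (by positivity) ?_
        have : ((i + j + 2 : ℕ) : ℝ) ≤ n + 1 := hΛn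
        have hn1' : (1 : ℝ) ≤ n := by exact_mod_cast hn1
        push_cast at this ⊢
        linarith only [this, hn1']
      have hT₂ : ((T'.filter fun t => ¬ t < j - i).card : ℝ) ≤ 4 * W + (ρ + 2) := by
        have hsub : (T'.filter fun t => ¬ t < j - i) ⊆
            (T'.filter fun t => j - i ≤ t ∧ t < i + j + 2) := by
          intro t ht
          rw [Finset.mem_filter] at ht ⊢
          exact ⟨ht.1, not_lt.1 ht.2, hT' t ht.1⟩
        have h1 := (Finset.card_le_card hsub).trans hcov
        have : (((T'.filter fun t => ¬ t < j - i).card : ℕ) : ℝ) ≤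
            ((4 * (T'.filter fun t => K ≤ t ∧ t < K + i).card + (ρ + 2) : ℕ) : ℝ) := by
          exact_mod_cast h1
        push_cast at this
        linarith only [this]
      have hT₂0 : (0 : ℝ) ≤ ((T'.filter fun t => ¬ t < j - i).card : ℝ) := Nat.cast_nonneg _
      have hWP : P ≤ W := by
        -- `c₂ w'/4 < |T₂| E ≤ (4W + ρ + 2) E` and `c₂ w' ≥ (16 P + 12 Q + 16 E) E`
        have h1 : c₂ * w' / 4 < (4 * W + (ρ + 2)) * E := by
          calc c₂ * w' / 4 < ((T'.filter fun t => ¬ t < j - i).card : ℝ) *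
                Real.logb 2 (2 * (i + j + 2 : ℕ)) := hfew'
            _ ≤ ((T'.filter fun t => ¬ t < j - i).card : ℝ) * E :=
                mul_le_mul_of_nonneg_left hlogΛ hT₂0
            _ ≤ (4 * W + (ρ + 2)) * E := mul_le_mul_of_nonneg_right hT₂ hE0
        have h2 : (4 * P + 3 * Q + 4 * E) * E ≤ c₂ * w' / 4 := by
          have e : (16 * P + 12 * Q + 16 * E) * E = 4 * ((4 * P + 3 * Q + 4 * E) * E) := by ring
          linarith only [hw2, hcw, e]
        have h5 : 4 * P + 3 * Q + 4 * E < 4 * W + (ρ + 2) :=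
          lt_of_mul_lt_mul_right (h2.trans_lt h1) hE0
        linarith only [h5, hρE, hE]
      -- the per-box type-II bound with `β = 1`
      have hF := hII T' i j ρ K (fun _ => 1) hij hρ1 hK hKj (fun _ => by simp)
      simp only [one_mul] at hF
      have hci : c * P ≤ c * i :=
        mul_le_mul_of_nonneg_left (by linarith only [hiP, hQ0, hE0]) hc.le
      have hcW : c * P ≤ c * W := mul_le_mul_of_nonneg_left hWP hc.le
      have h3 := three_savings_le (c := c) (C := C) (ρ := ρ) (m := (i : ℝ)) (W := W) (X := 3 * E)
        hcρ (by linarith only [hkey, hci]) (by linarith only [hkey, hcW])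
      refine hfinal (((i : ℝ) + j + 2) ^ C * (3 * (2 : ℝ) ^ (-(3 * E)))) (by positivity) ?_ ?_
      · have e : ((i : ℝ) + j + 2) = (Λ : ℝ) := by rw [hΛ]; push_cast; ring
        rw [e]
        have h0 : 0 ≤ (Λ : ℝ) ^ C * (2 : ℝ) ^ (-(3 * E)) := by positivity
        calc (Λ : ℝ) ^ C * (3 * (2 : ℝ) ^ (-(3 * E))) = 3 * ((Λ : ℝ) ^ C * (2 : ℝ) ^ (-(3 * E))) := by
              ring
          _ ≤ 4 * ((Λ : ℝ) ^ C * (2 : ℝ) ^ (-(3 * E))) := by linarith only [h0]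
          _ = 4 * (Λ : ℝ) ^ C * (2 : ℝ) ^ (-(3 * E)) := by ring
      · refine hF.trans ?_
        have h0 : 0 ≤ ((i : ℝ) + j + 2) ^ C * 2 ^ (i + j) := by positivity
        calc ((i : ℝ) + j + 2) ^ C * 2 ^ (i + j) *
              ((2 : ℝ) ^ (-(c * ρ)) + (2 : ℝ) ^ (C * ρ - c * i) + (2 : ℝ) ^ (C * ρ - c * W))
            ≤ ((i : ℝ) + j + 2) ^ C * 2 ^ (i + j) * (3 * (2 : ℝ) ^ (-(3 * E))) :=
              mul_le_mul_of_nonneg_left h3 h0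
          _ = 2 ^ (i + j) * (((i : ℝ) + j + 2) ^ C * (3 * (2 : ℝ) ^ (-(3 * E)))) := by ring

/-! ### The synthesis for large weight -/

/-- `log₂(8n) ≤ n^{1/10}` eventually. [folklore] -/
theorem eventually_logb_le_rpow_tenth :
    ∀ᶠ n : ℕ in atTop, Real.logb 2 (8 * n) ≤ (n : ℝ) ^ ((1 : ℝ) / 10) := by
  have hlog2 : 0 < Real.log 2 := Real.log_pos one_lt_two
  have hε : 0 < Real.log 2 / 2 := by positivity
  filter_upwards [eventually_log_le_mul_rpow_tenth hε,
    tendsto_rpow_tenth_atTop.eventually_ge_atTop (2 * Real.log 8 / Real.log 2),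
    eventually_ge_atTop 1] with n hlog hE hn1
  have hn0 : (0 : ℝ) < n := by exact_mod_cast hn1
  set E : ℝ := (n : ℝ) ^ ((1 : ℝ) / 10) with hEdef
  rw [Real.logb, div_le_iff₀ hlog2, Real.log_mul (by norm_num) hn0.ne']
  have h8 : Real.log 8 ≤ Real.log 2 / 2 * E := by
    have h3 : 2 * Real.log 8 / Real.log 2 * Real.log 2 ≤ E * Real.log 2 :=
      mul_le_mul_of_nonneg_right hE hlog2.le
    rw [div_mul_cancel₀ _ hlog2.ne'] at h3
    linarith
  linarith

/-- **The final numerics of the synthesis**: with `E ≥ 1`, `u = 2^{i_u}`, `i_u ≤ n/4`,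
`2^{s₀} ≥ 2^{3E}`, `8(n+1)⁴2^E ≤ B ≤ 16(n+1)⁴2^E` and the growth conditions
`384·2^{C+4} n^{C+6} ≤ 2^{E/2}`, `4E + 16 ≤ n`, the right-hand side of the box criterion with
`E_I = 2ⁿ·4(n+1)^{2+C/2}·2^{-3E/2}` and `E_II = (n+1)^C 2ⁿ·3·2^{-3E}` is `< 2^{n-E}` (six pieces,
each `≤ 2ⁿ2^{-E}/8`). [cite: Bourgain2013MoebiusWalsh, §3 (3.10)] -/
theorem final_numerics {n s₀ iu u B : ℕ} {C E : ℝ} (hn1 : 1 ≤ n) (hC : 1 ≤ C) (hE1 : 1 ≤ E)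
    (hpoly : 384 * (2 : ℝ) ^ (C + 4) * (n : ℝ) ^ (C + 6) ≤ (2 : ℝ) ^ ((1 / 2 : ℝ) * E))
    (hlinE : 4 * E + 16 ≤ n) (hs₀3 : 3 * E ≤ s₀) (hs₀n : s₀ ≤ n) (hiu4 : iu ≤ n / 4)
    (hudef : u = 2 ^ iu) (hB1 : 1 ≤ B) (hBge : 8 * ((n : ℝ) + 1) ^ 4 * (2 : ℝ) ^ E ≤ B)
    (hBle : (B : ℝ) ≤ 16 * ((n : ℝ) + 1) ^ 4 * (2 : ℝ) ^ E) :
    ((u : ℝ) + (Nat.sqrt (2 ^ n) : ℝ) * u) +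
        (n : ℝ) ^ 2 * (2 ^ n * (4 * ((n : ℝ) + 1) ^ (2 + C / 2)) * (2 : ℝ) ^ (-(3 * E) / 2) +
          2 ^ (n - s₀) * ((n : ℝ) + 1)) +
        B * ((n : ℝ) ^ 2 * (((n : ℝ) + 1) ^ C * 2 ^ n * (3 * (2 : ℝ) ^ (-(3 * E))) + 2 ^ (n - s₀))) +
        2 ^ n * ((n : ℝ) + 1) ^ 4 / B <
      (2 : ℝ) ^ ((n : ℝ) - E) := by
  set EI : ℝ := 2 ^ n * (4 * ((n : ℝ) + 1) ^ (2 + C / 2)) * (2 : ℝ) ^ (-(3 * E) / 2) with hEI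
  set EII : ℝ := ((n : ℝ) + 1) ^ C * 2 ^ n * (3 * (2 : ℝ) ^ (-(3 * E))) with hEII
  have hn0 : (0 : ℝ) < n := by exact_mod_cast hn1
  have hE0 : 0 ≤ E := by linarith
  have hC0 : 0 ≤ C := by linarith
  set Y : ℝ := 2 ^ n * (2 : ℝ) ^ (-E) with hY
  have hYeq : (2 : ℝ) ^ ((n : ℝ) - E) = Y := by
    rw [hY, sub_eq_add_neg, Real.rpow_add two_pos, Real.rpow_natCast]
  rw [hYeq]
  have hY0 : 0 < Y := by positivity
  have h2E0 : 0 < (2 : ℝ) ^ E := by positivity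
  have h2negE : (2 : ℝ) ^ (-E) = ((2 : ℝ) ^ E)⁻¹ := Real.rpow_neg (by norm_num) E
  have h2neg2E : (2 : ℝ) ^ (-(2 * E)) = (2 : ℝ) ^ (-E) * (2 : ℝ) ^ (-E) := by
    rw [← Real.rpow_add two_pos]; ring_nf
  have h2neg3E : (2 : ℝ) ^ (-(3 * E)) = (2 : ℝ) ^ (-(2 * E)) * (2 : ℝ) ^ (-E) := by
    rw [← Real.rpow_add two_pos]; ring_nf
  have h2half : (2 : ℝ) ^ ((1 / 2 : ℝ) * E) ≤ (2 : ℝ) ^ E :=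
    Real.rpow_le_rpow_of_exponent_le one_le_two (by linarith)
  -- `2^{n - s₀} ≤ 2ⁿ 2^{-3E}`
  have hpow_s₀ : (2 : ℝ) ^ (n - s₀) ≤ 2 ^ n * (2 : ℝ) ^ (-(3 * E)) := by
    have h1 : (2 : ℝ) ^ (n - s₀) * 2 ^ s₀ = 2 ^ n := by
      rw [← pow_add, Nat.sub_add_cancel hs₀n]
    have h2 : (2 : ℝ) ^ (3 * E) ≤ 2 ^ s₀ := by
      rw [← Real.rpow_natCast]
      exact Real.rpow_le_rpow_of_exponent_le one_le_two hs₀3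
    have h3 : (2 : ℝ) ^ (n - s₀) * (2 : ℝ) ^ (3 * E) ≤ 2 ^ n := by
      calc (2 : ℝ) ^ (n - s₀) * (2 : ℝ) ^ (3 * E) ≤ (2 : ℝ) ^ (n - s₀) * 2 ^ s₀ := by gcongr
        _ = 2 ^ n := h1
    have h4 : (2 : ℝ) ^ (3 * E) * (2 : ℝ) ^ (-(3 * E)) = 1 := by
      rw [← Real.rpow_add two_pos]; simp
    calc (2 : ℝ) ^ (n - s₀) = (2 : ℝ) ^ (n - s₀) * ((2 : ℝ) ^ (3 * E) * (2 : ℝ) ^ (-(3 * E))) := by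
          rw [h4, mul_one]
      _ = ((2 : ℝ) ^ (n - s₀) * (2 : ℝ) ^ (3 * E)) * (2 : ℝ) ^ (-(3 * E)) := by ring
      _ ≤ 2 ^ n * (2 : ℝ) ^ (-(3 * E)) := mul_le_mul_of_nonneg_right h3 (by positivity)
  -- polynomial facts
  have hn1poly : ((n : ℝ) + 1) ^ (C + 4) ≤ (2 : ℝ) ^ (C + 4) * (n : ℝ) ^ (C + 4) := by
    rw [← Real.mul_rpow (by norm_num) hn0.le]
    exact Real.rpow_le_rpow (by positivity) (by linarith [show (1 : ℝ) ≤ n by exact_mod_cast hn1])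
      (by linarith)
  have hnC4 : (n : ℝ) ^ 2 * (n : ℝ) ^ (C + 4) = (n : ℝ) ^ (C + 6) := by
    rw [← Real.rpow_natCast, ← Real.rpow_add hn0]; norm_num; ring_nf
  have hmaster : 384 * (n : ℝ) ^ 2 * ((n : ℝ) + 1) ^ (C + 4) ≤ (2 : ℝ) ^ ((1 / 2 : ℝ) * E) := by
    calc 384 * (n : ℝ) ^ 2 * ((n : ℝ) + 1) ^ (C + 4)
        ≤ 384 * (n : ℝ) ^ 2 * ((2 : ℝ) ^ (C + 4) * (n : ℝ) ^ (C + 4)) := by gcongr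
      _ = 384 * (2 : ℝ) ^ (C + 4) * ((n : ℝ) ^ 2 * (n : ℝ) ^ (C + 4)) := by ring
      _ = 384 * (2 : ℝ) ^ (C + 4) * (n : ℝ) ^ (C + 6) := by rw [hnC4]
      _ ≤ (2 : ℝ) ^ ((1 / 2 : ℝ) * E) := hpoly
  have hn1_4 : ((n : ℝ) + 1) ^ 4 ≤ ((n : ℝ) + 1) ^ (C + 4) := by
    have : ((n : ℝ) + 1) ^ ((4 : ℕ) : ℝ) ≤ ((n : ℝ) + 1) ^ (C + 4) :=
      Real.rpow_le_rpow_of_exponent_le (by linarith) (by push_cast; linarith)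
    rwa [Real.rpow_natCast] at this
  have hn1_2C : ((n : ℝ) + 1) ^ (2 + C / 2) ≤ ((n : ℝ) + 1) ^ (C + 4) :=
    Real.rpow_le_rpow_of_exponent_le (by linarith) (by linarith)
  have hn2_1 : (1 : ℝ) ≤ (n : ℝ) ^ 2 := one_le_pow₀ (by exact_mod_cast hn1)
  -- piece 1: `u + ⌊√2ⁿ⌋ u ≤ Y/8`
  have hP1 : (u : ℝ) + (Nat.sqrt (2 ^ n) : ℝ) * u ≤ Y / 8 := by
    have hu : (u : ℝ) ≤ (2 : ℝ) ^ ((n : ℝ) / 4) := by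
      have h1 : (u : ℝ) = (2 : ℝ) ^ ((iu : ℕ) : ℝ) := by
        rw [hudef, Real.rpow_natCast]; push_cast; rfl
      rw [h1]
      refine Real.rpow_le_rpow_of_exponent_le one_le_two ?_
      calc ((iu : ℕ) : ℝ) ≤ ((n / 4 : ℕ) : ℝ) := by exact_mod_cast hiu4
        _ ≤ (n : ℝ) / 4 := Nat.cast_div_le
    have hsq : ((Nat.sqrt (2 ^ n) : ℕ) : ℝ) ≤ (2 : ℝ) ^ ((n : ℝ) / 2) := by
      have h1 : ((Nat.sqrt (2 ^ n) : ℕ) : ℝ) ^ 2 ≤ ((2 : ℝ) ^ ((n : ℝ) / 2)) ^ 2 := by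
        have h2 : (Nat.sqrt (2 ^ n)) ^ 2 ≤ 2 ^ n := Nat.sqrt_le' _
        have h3 : (((Nat.sqrt (2 ^ n)) ^ 2 : ℕ) : ℝ) ≤ ((2 ^ n : ℕ) : ℝ) := by exact_mod_cast h2
        push_cast at h3
        have h4 : ((2 : ℝ) ^ ((n : ℝ) / 2)) ^ 2 = 2 ^ n := by
          rw [← Real.rpow_natCast, ← Real.rpow_mul (by norm_num)]
          norm_num
        rw [h4]; exact h3
      exact (pow_le_pow_iff_left₀ (by positivity) (by positivity) (by norm_num)).1 h1
    have h1 : (1 : ℝ) ≤ (2 : ℝ) ^ ((n : ℝ) / 2) := Real.one_le_rpow one_le_two (by positivity)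
    have hexp : (2 : ℝ) ^ ((n : ℝ) / 4) * (2 * (2 : ℝ) ^ ((n : ℝ) / 2)) * 8 ≤ Y := by
      have e1 : (2 : ℝ) ^ ((n : ℝ) / 4) * (2 * (2 : ℝ) ^ ((n : ℝ) / 2)) * 8 =
          (2 : ℝ) ^ ((n : ℝ) / 4 + (n : ℝ) / 2 + 4) := by
        have e8 : (8 : ℝ) = (2 : ℝ) ^ (3 : ℝ) := by norm_num
        rw [e8, Real.rpow_add two_pos, Real.rpow_add two_pos,
          show (4 : ℝ) = 1 + 3 by norm_num, Real.rpow_add two_pos, Real.rpow_one]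
        ring
      have e2 : Y = (2 : ℝ) ^ ((n : ℝ) + -E) := by
        rw [hY, Real.rpow_add two_pos, Real.rpow_natCast]
      rw [e1, e2]
      refine Real.rpow_le_rpow_of_exponent_le one_le_two ?_
      linarith
    calc (u : ℝ) + (Nat.sqrt (2 ^ n) : ℝ) * u = (u : ℝ) * (1 + (Nat.sqrt (2 ^ n) : ℝ)) := by ring
      _ ≤ (2 : ℝ) ^ ((n : ℝ) / 4) * (1 + (2 : ℝ) ^ ((n : ℝ) / 2)) :=
          mul_le_mul hu (by linarith) (by positivity) (by positivity)
      _ ≤ (2 : ℝ) ^ ((n : ℝ) / 4) * (2 * (2 : ℝ) ^ ((n : ℝ) / 2)) :=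
          mul_le_mul_of_nonneg_left (by linarith) (by positivity)
      _ ≤ Y / 8 := by linarith only [hexp]
  -- piece 2: `n² EI ≤ Y/8`
  have hP2 : (n : ℝ) ^ 2 * EI ≤ Y / 8 := by
    have h1 : 32 * (n : ℝ) ^ 2 * ((n : ℝ) + 1) ^ (2 + C / 2) ≤ (2 : ℝ) ^ ((1 / 2 : ℝ) * E) := by
      calc 32 * (n : ℝ) ^ 2 * ((n : ℝ) + 1) ^ (2 + C / 2)
          ≤ 384 * (n : ℝ) ^ 2 * ((n : ℝ) + 1) ^ (C + 4) := by
            have h0 : 0 ≤ (n : ℝ) ^ 2 * ((n : ℝ) + 1) ^ (2 + C / 2) := by positivity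
            have h1 := mul_le_mul_of_nonneg_left hn1_2C (by positivity : (0 : ℝ) ≤ (n : ℝ) ^ 2)
            linarith only [h0, h1]
        _ ≤ (2 : ℝ) ^ ((1 / 2 : ℝ) * E) := hmaster
    have e : (2 : ℝ) ^ (-(3 * E) / 2) = (2 : ℝ) ^ (-E) * ((2 : ℝ) ^ ((1 / 2 : ℝ) * E))⁻¹ := by
      rw [← Real.rpow_neg (by norm_num), ← Real.rpow_add two_pos]; ring_nf
    have hhalf0 : 0 < (2 : ℝ) ^ ((1 / 2 : ℝ) * E) := by positivity
    rw [hEI, e, hY]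
    have key : (n : ℝ) ^ 2 * (4 * ((n : ℝ) + 1) ^ (2 + C / 2)) * ((2 : ℝ) ^ ((1 / 2 : ℝ) * E))⁻¹ ≤
        1 / 8 := by
      rw [← div_eq_mul_inv, div_le_iff₀ hhalf0]
      linarith only [h1]
    have h2n : 0 ≤ (2 : ℝ) ^ n * (2 : ℝ) ^ (-E) := by positivity
    calc (n : ℝ) ^ 2 * (2 ^ n * (4 * ((n : ℝ) + 1) ^ (2 + C / 2)) *
          ((2 : ℝ) ^ (-E) * ((2 : ℝ) ^ ((1 / 2 : ℝ) * E))⁻¹))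
        = (2 ^ n * (2 : ℝ) ^ (-E)) *
            ((n : ℝ) ^ 2 * (4 * ((n : ℝ) + 1) ^ (2 + C / 2)) * ((2 : ℝ) ^ ((1 / 2 : ℝ) * E))⁻¹) := by
          ring
      _ ≤ (2 ^ n * (2 : ℝ) ^ (-E)) * (1 / 8) := mul_le_mul_of_nonneg_left key h2n
      _ = 2 ^ n * (2 : ℝ) ^ (-E) / 8 := by ring
  -- piece 3: `n² 2^{n-s₀} (n+1) ≤ Y/8`
  have hP3 : (n : ℝ) ^ 2 * (2 ^ (n - s₀) * ((n : ℝ) + 1)) ≤ Y / 8 := by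
    have h1 : 8 * (n : ℝ) ^ 2 * ((n : ℝ) + 1) ≤ (2 : ℝ) ^ E := by
      have : 8 * (n : ℝ) ^ 2 * ((n : ℝ) + 1) ≤ 384 * (n : ℝ) ^ 2 * ((n : ℝ) + 1) ^ (C + 4) := by
        have h3 : (n : ℝ) + 1 ≤ ((n : ℝ) + 1) ^ (C + 4) := by
          have := Real.rpow_le_rpow_of_exponent_le (show (1 : ℝ) ≤ n + 1 by linarith)
            (show (1 : ℝ) ≤ C + 4 by linarith)
          rwa [Real.rpow_one] at this
        have h4 := mul_le_mul_of_nonneg_left h3 (by positivity : (0 : ℝ) ≤ (n : ℝ) ^ 2)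
        have h5 : 0 ≤ (n : ℝ) ^ 2 * ((n : ℝ) + 1) := by positivity
        linarith only [h4, h5]
      linarith only [this, hmaster, h2half]
    have h2 : (2 : ℝ) ^ (-(2 * E)) * (2 : ℝ) ^ E ≤ 1 := by
      have e : (2 : ℝ) ^ (-(2 * E)) * (2 : ℝ) ^ E = ((2 : ℝ) ^ E)⁻¹ := by
        rw [← Real.rpow_add two_pos, ← Real.rpow_neg (by norm_num)]; ring_nf
      rw [e]
      have h1E : (1 : ℝ) ≤ (2 : ℝ) ^ E := Real.one_le_rpow one_le_two hE0
      exact inv_le_one_of_one_le₀ h1E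
    have h0 : 0 ≤ (2 : ℝ) ^ n * (2 : ℝ) ^ (-E) := by positivity
    have h22 : 0 ≤ (2 : ℝ) ^ (-(2 * E)) := by positivity
    calc (n : ℝ) ^ 2 * (2 ^ (n - s₀) * ((n : ℝ) + 1))
        ≤ (n : ℝ) ^ 2 * (2 ^ n * (2 : ℝ) ^ (-(3 * E)) * ((n : ℝ) + 1)) := by gcongr
      _ = (2 ^ n * (2 : ℝ) ^ (-E)) * ((2 : ℝ) ^ (-(2 * E)) * ((n : ℝ) ^ 2 * ((n : ℝ) + 1))) := by
          rw [h2neg3E]; ring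
      _ ≤ (2 ^ n * (2 : ℝ) ^ (-E)) * ((2 : ℝ) ^ (-(2 * E)) * ((2 : ℝ) ^ E / 8)) := by
          refine mul_le_mul_of_nonneg_left (mul_le_mul_of_nonneg_left ?_ h22) h0
          linarith only [h1]
      _ = (2 ^ n * (2 : ℝ) ^ (-E)) * ((2 : ℝ) ^ (-(2 * E)) * (2 : ℝ) ^ E) / 8 := by ring
      _ ≤ (2 ^ n * (2 : ℝ) ^ (-E)) * 1 / 8 := by
          have h7 := mul_le_mul_of_nonneg_left h2 h0
          linarith only [h7]
      _ = Y / 8 := by rw [hY]; ring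
  -- piece 4: `B n² EII ≤ Y/8`
  have hP4 : (B : ℝ) * ((n : ℝ) ^ 2 * EII) ≤ Y / 8 := by
    have h1 : 384 * (n : ℝ) ^ 2 * ((n : ℝ) + 1) ^ (C + 4) ≤ (2 : ℝ) ^ E := hmaster.trans h2half
    have hprod : ((n : ℝ) + 1) ^ 4 * ((n : ℝ) + 1) ^ C = ((n : ℝ) + 1) ^ (C + 4) := by
      rw [← Real.rpow_natCast, ← Real.rpow_add (by linarith)]; push_cast; ring_nf
    have e : (2 : ℝ) ^ E * ((2 : ℝ) ^ (-E) * (2 : ℝ) ^ (-E)) = (2 : ℝ) ^ (-E) := by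
      rw [← mul_assoc, ← Real.rpow_add two_pos]; simp
    calc (B : ℝ) * ((n : ℝ) ^ 2 * EII)
        ≤ (16 * ((n : ℝ) + 1) ^ 4 * (2 : ℝ) ^ E) * ((n : ℝ) ^ 2 * EII) :=
          mul_le_mul_of_nonneg_right hBle (by positivity)
      _ = (2 ^ n * (2 : ℝ) ^ (-E)) * (48 * (n : ℝ) ^ 2 * (((n : ℝ) + 1) ^ 4 * ((n : ℝ) + 1) ^ C) *
            ((2 : ℝ) ^ E * ((2 : ℝ) ^ (-E) * (2 : ℝ) ^ (-E)))) := by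
          rw [hEII, h2neg3E, h2neg2E]; ring
      _ = (2 ^ n * (2 : ℝ) ^ (-E)) * (48 * (n : ℝ) ^ 2 * ((n : ℝ) + 1) ^ (C + 4) * (2 : ℝ) ^ (-E)) := by
          rw [hprod, e]
      _ ≤ (2 ^ n * (2 : ℝ) ^ (-E)) * (1 / 8) := by
          refine mul_le_mul_of_nonneg_left ?_ (by positivity)
          rw [h2negE, ← div_eq_mul_inv, div_le_iff₀ h2E0]
          linarith only [h1]
      _ = Y / 8 := by rw [hY]; ring
  -- piece 5: `B n² 2^{n-s₀} ≤ Y/8`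
  have hP5 : (B : ℝ) * ((n : ℝ) ^ 2 * 2 ^ (n - s₀)) ≤ Y / 8 := by
    have h1 : 128 * (n : ℝ) ^ 2 * ((n : ℝ) + 1) ^ 4 ≤ (2 : ℝ) ^ E := by
      have : 128 * (n : ℝ) ^ 2 * ((n : ℝ) + 1) ^ 4 ≤ 384 * (n : ℝ) ^ 2 * ((n : ℝ) + 1) ^ (C + 4) := by
        have h4 := mul_le_mul_of_nonneg_left hn1_4 (by positivity : (0 : ℝ) ≤ (n : ℝ) ^ 2)
        have h5 : 0 ≤ (n : ℝ) ^ 2 * ((n : ℝ) + 1) ^ 4 := by positivity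
        linarith only [h4, h5]
      exact this.trans (hmaster.trans h2half)
    have e : (2 : ℝ) ^ E * ((2 : ℝ) ^ (-E) * (2 : ℝ) ^ (-E)) = (2 : ℝ) ^ (-E) := by
      rw [← mul_assoc, ← Real.rpow_add two_pos]; simp
    calc (B : ℝ) * ((n : ℝ) ^ 2 * 2 ^ (n - s₀))
        ≤ (16 * ((n : ℝ) + 1) ^ 4 * (2 : ℝ) ^ E) * ((n : ℝ) ^ 2 * (2 ^ n * (2 : ℝ) ^ (-(3 * E)))) := by
          gcongr
      _ = (2 ^ n * (2 : ℝ) ^ (-E)) * (16 * (n : ℝ) ^ 2 * ((n : ℝ) + 1) ^ 4 *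
            ((2 : ℝ) ^ E * ((2 : ℝ) ^ (-E) * (2 : ℝ) ^ (-E)))) := by
          rw [h2neg3E, h2neg2E]; ring
      _ = (2 ^ n * (2 : ℝ) ^ (-E)) * (16 * (n : ℝ) ^ 2 * ((n : ℝ) + 1) ^ 4 * (2 : ℝ) ^ (-E)) := by
          rw [e]
      _ ≤ (2 ^ n * (2 : ℝ) ^ (-E)) * (1 / 8) := by
          refine mul_le_mul_of_nonneg_left ?_ (by positivity)
          rw [h2negE, ← div_eq_mul_inv, div_le_iff₀ h2E0]
          linarith only [h1]
      _ = Y / 8 := by rw [hY]; ring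
  -- piece 6: `2ⁿ (n+1)⁴ / B ≤ Y/8`
  have hP6 : 2 ^ n * ((n : ℝ) + 1) ^ 4 / B ≤ Y / 8 := by
    have hB0 : (0 : ℝ) < B := by exact_mod_cast hB1
    rw [div_le_iff₀ hB0, hY]
    have e : (2 : ℝ) ^ (-E) * (2 : ℝ) ^ E = 1 := by rw [← Real.rpow_add two_pos]; simp
    calc (2 : ℝ) ^ n * ((n : ℝ) + 1) ^ 4
        = 2 ^ n * (2 : ℝ) ^ (-E) / 8 * (8 * ((n : ℝ) + 1) ^ 4 * (2 : ℝ) ^ E) := by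
          calc (2 : ℝ) ^ n * ((n : ℝ) + 1) ^ 4
              = 2 ^ n * ((n : ℝ) + 1) ^ 4 * ((2 : ℝ) ^ (-E) * (2 : ℝ) ^ E) := by rw [e, mul_one]
            _ = _ := by ring
      _ ≤ 2 ^ n * (2 : ℝ) ^ (-E) / 8 * B := by gcongr
  -- conclusion
  have htotal : ((u : ℝ) + (Nat.sqrt (2 ^ n) : ℝ) * u) + (n : ℝ) ^ 2 * (EI + 2 ^ (n - s₀) * ((n : ℝ) + 1)) +
      B * ((n : ℝ) ^ 2 * (EII + 2 ^ (n - s₀))) + 2 ^ n * ((n : ℝ) + 1) ^ 4 / B ≤ 6 * (Y / 8) := by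
    have e1 : (n : ℝ) ^ 2 * (EI + 2 ^ (n - s₀) * ((n : ℝ) + 1)) =
        (n : ℝ) ^ 2 * EI + (n : ℝ) ^ 2 * (2 ^ (n - s₀) * ((n : ℝ) + 1)) := by ring
    have e2 : (B : ℝ) * ((n : ℝ) ^ 2 * (EII + 2 ^ (n - s₀))) =
        (B : ℝ) * ((n : ℝ) ^ 2 * EII) + (B : ℝ) * ((n : ℝ) ^ 2 * 2 ^ (n - s₀)) := by ring
    rw [e1, e2]
    linarith only [hP1, hP2, hP3, hP4, hP5, hP6]
  have hfin : 6 * (Y / 8) < Y := by linarith only [hY0]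
  exact lt_of_le_of_lt htotal hfin

/-- **Bourgain 2013, Theorem 1 for `λ`, large weight.** Under the per-box TYPE-II bound `hII`
(the content of §2 of the paper, in the shape: short side `D_i`, long side `D_j` with a
coefficient `|β| ≤ 1`, lag parameter `L = 2^ρ`, admissible window `[K, K+i)`, savings
`2^{-cρ} + 2^{Cρ-ci} + 2^{Cρ-c|T ∩ [K,K+i)|}` up to `(i+j+2)^C`), for `n` beyond three explicit
growth conditions and `|A|` beyond the small-weight range, `|walshSum λ A| < 2^{n - n^{1/10}}`:
the box criterion `abs_walshSum_liouville_le_of_boxBounds` with `u = 2^{n/4 - s₀}`,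
`s₀ = ⌈3E⌉`, `B = ⌈8(n+1)⁴2^E⌉`, `ρ = ⌈3E/c⌉`, `E = n^{1/10}`, the boxes being estimated by
`boxI_bound` and `boxII_bound`. [cite: Bourgain2013MoebiusWalsh, §3 (3.10), Theorem 1 (remark on λ)] -/
theorem walshSum_liouville_largeWeight {c C : ℝ} (hc : 0 < c) (hC : 1 ≤ C)
    (hII : ∀ (T : Finset ℕ) (i j ρ K : ℕ) (β : ℕ → ℝ), i ≤ j → 1 ≤ ρ →
        (K = 0 ∨ (i ≤ K + ρ ∧ 4 * ρ < K)) → K + ρ ≤ j → (∀ b, |β b| ≤ 1) →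
        ∑ a ∈ dyBlock i, |∑ b ∈ dyBlock j, β b * natWalsh T (a * b)| ≤
          ((i : ℝ) + j + 2) ^ C * 2 ^ (i + j) *
            ((2 : ℝ) ^ (-(c * ρ)) + (2 : ℝ) ^ (C * ρ - c * i) +
              (2 : ℝ) ^ (C * ρ - c * ((T.filter fun t => K ≤ t ∧ t < K + i).card : ℝ))))
    {n : ℕ} (hn1 : 1 ≤ n)
    (hlog : Real.logb 2 (8 * n) ≤ (n : ℝ) ^ ((1 : ℝ) / 10))
    (hpoly : 384 * (2 : ℝ) ^ (C + 4) * (n : ℝ) ^ (C + 6) ≤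
      (2 : ℝ) ^ ((1 / 2 : ℝ) * (n : ℝ) ^ ((1 : ℝ) / 10)))
    (hlin : (60 + 6 * ((3 * C / c + C + 3) / c) + 90 / c) * (n : ℝ) ^ ((1 : ℝ) / 10) ≤ n)
    (A : Finset (Fin n))
    (hwI : (16 * ((3 * C / c + C + 3) / c * (n : ℝ) ^ ((1 : ℝ) / 10)) +
          12 * ((n : ℝ) ^ ((1 : ℝ) / 10) / c) + 16 * (n : ℝ) ^ ((1 : ℝ) / 10)) *
          (n : ℝ) ^ ((1 : ℝ) / 10) +
        2 * ((3 * C / c + C + 3) / c * (n : ℝ) ^ ((1 : ℝ) / 10)) +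
          30 * ((n : ℝ) ^ ((1 : ℝ) / 10) / c) + 22 * (n : ℝ) ^ ((1 : ℝ) / 10) ≤
        walshSupExponent * A.card)
    (hwII : 12 * ((3 * C / c + C + 3) / c * (n : ℝ) ^ ((1 : ℝ) / 10)) +
        18 * ((n : ℝ) ^ ((1 : ℝ) / 10) / c) + 30 * (n : ℝ) ^ ((1 : ℝ) / 10) ≤ A.card) :
    |walshSum (fun m => (ArithmeticFunction.liouville m : ℤ)) A| <
      (2 : ℝ) ^ ((n : ℝ) - (n : ℝ) ^ ((1 : ℝ) / 10)) := by
  classical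
  set E : ℝ := (n : ℝ) ^ ((1 : ℝ) / 10) with hEdef
  set P : ℝ := (3 * C / c + C + 3) / c * E with hP
  set Q : ℝ := E / c with hQ
  set c₂ : ℝ := walshSupExponent with hc₂
  have hc₂0 : 0 < c₂ := walshSupExponent_pos
  have hc₂1 : c₂ ≤ 1 := walshSupExponent_le_one
  have hn0 : (0 : ℝ) < n := by exact_mod_cast hn1
  have hE1 : 1 ≤ E := by
    rw [hEdef]; exact Real.one_le_rpow (by exact_mod_cast hn1) (by norm_num)
  have hE0 : 0 ≤ E := by linarith
  have hC0 : 0 ≤ C := by linarith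
  have hQ0 : 0 ≤ Q := by rw [hQ]; positivity
  have hP0 : 0 ≤ P := by rw [hP]; positivity
  clear_value E
  -- parameters
  set ρ : ℕ := ⌈3 * E / c⌉₊ with hρdef
  set s₀ : ℕ := ⌈3 * E⌉₊ with hs₀def
  have h3Ec : 0 < 3 * E / c := by positivity
  have hρ1 : 1 ≤ ρ := Nat.one_le_ceil_iff.2 h3Ec
  have hρE : (ρ : ℝ) ≤ 3 * (E / c) + E := by
    have h1 : (ρ : ℝ) < 3 * E / c + 1 := Nat.ceil_lt_add_one h3Ec.le
    have h2 : 3 * E / c = 3 * (E / c) := by ring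
    linarith only [h1, h2, hE1]
  have hcρ : 3 * E ≤ c * ρ := by
    have h1 : 3 * E / c ≤ ρ := Nat.le_ceil _
    have h2 : 3 * E / c * c = 3 * E := by field_simp
    have := mul_le_mul_of_nonneg_right h1 hc.le
    linarith only [this, h2]
  have hs₀E : (s₀ : ℝ) ≤ 4 * E := by
    have h1 : (s₀ : ℝ) < 3 * E + 1 := Nat.ceil_lt_add_one (by positivity)
    linarith only [h1, hE1]
  have hs₀3 : 3 * E ≤ s₀ := Nat.le_ceil _
  clear_value ρ s₀
  -- linear facts in `n`
  have hlin' : 60 * E + 6 * P + 90 * Q ≤ n := by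
    have : (60 + 6 * ((3 * C / c + C + 3) / c) + 90 / c) * E = 60 * E + 6 * P + 90 * Q := by
      rw [hP, hQ]; ring
    linarith only [hlin, this]
  have hmE : P + 15 * Q + 5 * E ≤ (n : ℝ) / 6 := by linarith only [hlin', hE0]
  have h12 : 12 * s₀ + 12 ≤ n := by
    have : ((12 * s₀ + 12 : ℕ) : ℝ) ≤ n := by
      push_cast
      linarith only [hs₀E, hE1, hlin', hP0, hQ0]
    exact_mod_cast this
  have hs₀n : s₀ ≤ n := by omega
  have hlinE : 4 * E + 16 ≤ n := by linarith only [hlin', hE1, hP0, hQ0]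
  set iu : ℕ := n / 4 - s₀ with hiudef
  have hiu6 : n < 6 * iu := by omega
  have hiu4 : iu ≤ n / 4 := Nat.sub_le _ _
  clear_value iu
  set u : ℕ := 2 ^ iu with hudef
  clear_value u
  -- polynomial facts in `n`
  have h2half : (2 : ℝ) ^ ((1 / 2 : ℝ) * E) ≤ (2 : ℝ) ^ E :=
    Real.rpow_le_rpow_of_exponent_le one_le_two (by linarith)
  have hnC : (n : ℝ) ≤ (n : ℝ) ^ (C + 6) := by
    have := Real.rpow_le_rpow_of_exponent_le (show (1 : ℝ) ≤ n by exact_mod_cast hn1)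
      (show (1 : ℝ) ≤ C + 6 by linarith)
    rwa [Real.rpow_one] at this
  have h2C : (1 : ℝ) ≤ (2 : ℝ) ^ (C + 4) := Real.one_le_rpow one_le_two (by linarith)
  have hbigpoly : 384 * (n : ℝ) ≤ (2 : ℝ) ^ E := by
    have h1 : 384 * (n : ℝ) ≤ 384 * (2 : ℝ) ^ (C + 4) * (n : ℝ) ^ (C + 6) := by
      have : (n : ℝ) * 1 ≤ (n : ℝ) ^ (C + 6) * (2 : ℝ) ^ (C + 4) :=
        mul_le_mul hnC h2C zero_le_one (by positivity)
      linarith only [this]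
    linarith only [h1, hpoly, h2half]
  have h2E : 12 * ((n : ℝ) + 3) ≤ (2 : ℝ) ^ E := by
    have : (1 : ℝ) ≤ n := by exact_mod_cast hn1
    linarith only [this, hbigpoly]
  -- `B`
  set B : ℕ := ⌈8 * ((n : ℝ) + 1) ^ 4 * (2 : ℝ) ^ E⌉₊ with hBdef
  have hBpos : (0 : ℝ) < 8 * ((n : ℝ) + 1) ^ 4 * (2 : ℝ) ^ E := by positivity
  have hB1 : 1 ≤ B := Nat.one_le_ceil_iff.2 hBpos
  have hBge : 8 * ((n : ℝ) + 1) ^ 4 * (2 : ℝ) ^ E ≤ B := Nat.le_ceil _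
  have hBle : (B : ℝ) ≤ 16 * ((n : ℝ) + 1) ^ 4 * (2 : ℝ) ^ E := by
    have h1 : (B : ℝ) < 8 * ((n : ℝ) + 1) ^ 4 * (2 : ℝ) ^ E + 1 := Nat.ceil_lt_add_one hBpos.le
    have h2 : (1 : ℝ) ≤ 8 * ((n : ℝ) + 1) ^ 4 * (2 : ℝ) ^ E := by
      have h3 : (1 : ℝ) ≤ ((n : ℝ) + 1) ^ 4 := one_le_pow₀ (by linarith)
      have h4 : (1 : ℝ) ≤ (2 : ℝ) ^ E := Real.one_le_rpow one_le_two hE0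
      have h5 : (1 : ℝ) * 1 ≤ ((n : ℝ) + 1) ^ 4 * (2 : ℝ) ^ E :=
        mul_le_mul h3 h4 zero_le_one (by positivity)
      linarith only [h5]
    linarith only [h1, h2]
  clear_value B
  -- `S`
  set S : Finset ℕ := A.map Fin.valEmbedding with hSdef
  have hS : ∀ s ∈ S, s < n := by
    intro s hs
    rw [hSdef, Finset.mem_map] at hs
    obtain ⟨x, _, rfl⟩ := hs
    exact x.isLt
  have hScard : (S.card : ℝ) = A.card := by rw [hSdef, Finset.card_map]
  -- the weight hypotheses in the form of the per-box lemmas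
  have hwI' : (16 * P + 12 * Q + 16 * E) * E + 2 * P + 30 * Q + 22 * E ≤ c₂ * S.card := by
    rw [hScard]; exact hwI
  have hwII' : 12 * P + 18 * Q + 30 * E ≤ S.card := by rw [hScard]; exact hwII
  have hcs₀ : c₂ * (s₀ : ℝ) ≤ 4 * E := by
    have h1 : c₂ * (s₀ : ℝ) ≤ 1 * s₀ := mul_le_mul_of_nonneg_right hc₂1 (Nat.cast_nonneg _)
    linarith only [h1, hs₀E]
  have hcS : c₂ * ((S.card : ℝ) - s₀) = c₂ * S.card - c₂ * s₀ := by ring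
  have hPQE : 0 ≤ (16 * P + 12 * Q + 16 * E) * E := by positivity
  have hw1 : 8 * E ≤ c₂ * ((S.card : ℝ) - s₀) := by
    linarith only [hwI', hcs₀, hcS, hPQE, hP0, hQ0, hE0]
  have hw2 : (16 * P + 12 * Q + 16 * E) * E ≤ c₂ * ((S.card : ℝ) - s₀) := by
    linarith only [hwI', hcs₀, hcS, hPQE, hP0, hQ0, hE0]
  have hw3 : 2 * P + 30 * Q + 10 * E ≤ c₂ * ((S.card : ℝ) - s₀) := by
    linarith only [hwI', hcs₀, hcS, hPQE, hP0, hQ0, hE0]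
  -- the per-box bounds
  set EI : ℝ := 2 ^ n * (4 * ((n : ℝ) + 1) ^ (2 + C / 2)) * (2 : ℝ) ^ (-(3 * E) / 2) with hEI
  set EII : ℝ := ((n : ℝ) + 1) ^ C * 2 ^ n * (3 * (2 : ℝ) ^ (-(3 * E))) with hEII
  have hST_of : ∀ T : Finset ℕ, (T = S ∨ T = insert n S) → S ⊆ T := by
    rintro T (rfl | rfl)
    · exact subset_rfl
    · exact Finset.subset_insert _ _
  have hI : ∀ T : Finset ℕ, (T = S ∨ T = insert n S) →
      ∀ i j : ℕ, i + j < n → n ≤ i + j + s₀ →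
        |boxSum T i j (liouvTypeICoeff u) (fun _ => 1)| ≤ EI := by
    intro T hT i j hij hs
    have hST := hST_of T hT
    by_cases hvan : u * u < 2 ^ i
    · -- the type-I coefficient vanishes on `D_i`
      have h0 : boxSum T i j (liouvTypeICoeff u) (fun _ => 1) = 0 := by
        simp only [boxSum]
        refine Finset.sum_eq_zero fun a ha => ?_
        have ha' : u * u < a := lt_of_lt_of_le hvan (mem_dyBlock.1 ha).1
        simp [liouvTypeICoeff_eq_zero ha']
      rw [h0, abs_zero]; positivity
    · have hi : 2 ^ i ≤ u * u := not_lt.1 hvan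
      have hi2 : i ≤ 2 * iu := by
        have h1 : 2 ^ i ≤ 2 ^ (2 * iu) := by
          rw [two_mul, pow_add, ← hudef]; exact hi
        exact (Nat.pow_le_pow_iff_right (by norm_num)).1 h1
      have hij' : i ≤ j := by omega
      exact boxI_bound hc hC hII hE1 hn1 hρ1 hρE hcρ hlog h2E S T hS hST hij' hij hs hw1 hw2 hw3
        (abs_liouvTypeICoeff_le u)
  have hII' : ∀ T : Finset ℕ, (T = S ∨ T = insert n S) →
      ∀ i j : ℕ, i + j < n → n ≤ i + j + s₀ →
        |boxSum T i j (typeIICoeffA u B) (liouvTypeIICoeffB u)| ≤ EII := by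
    intro T hT i j hij hs
    have hST := hST_of T hT
    have hEII0 : 0 ≤ EII := by positivity
    by_cases hvi : 2 ^ (i + 1) ≤ u
    · have h0 : boxSum T i j (typeIICoeffA u B) (liouvTypeIICoeffB u) = 0 := by
        simp only [boxSum]
        refine Finset.sum_eq_zero fun a ha => ?_
        have ha' : a ≤ u := by have := (mem_dyBlock.1 ha).2; omega
        simp [typeIICoeffA_eq_zero B ha']
      rw [h0, abs_zero]; exact hEII0
    by_cases hvj : 2 ^ (j + 1) ≤ u
    · have h0 : boxSum T i j (typeIICoeffA u B) (liouvTypeIICoeffB u) = 0 := by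
        simp only [boxSum]
        refine Finset.sum_eq_zero fun a ha => Finset.sum_eq_zero fun b hb => ?_
        have hb' : b ≤ u := by have := (mem_dyBlock.1 hb).2; omega
        simp [liouvTypeIICoeffB_eq_zero hb']
      rw [h0, abs_zero]; exact hEII0
    have hiui : iu ≤ i := by
      have h1 : 2 ^ iu < 2 ^ (i + 1) := by rw [← hudef]; exact not_le.1 hvi
      have := (Nat.pow_lt_pow_iff_right (by norm_num)).1 h1
      omega
    have hiuj : iu ≤ j := by
      have h1 : 2 ^ iu < 2 ^ (j + 1) := by rw [← hudef]; exact not_le.1 hvj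
      have := (Nat.pow_lt_pow_iff_right (by norm_num)).1 h1
      omega
    rcases le_total i j with hle | hle
    · have hF := boxII_bound hc hC hII hE1 hρ1 hρE hcρ hs₀E S T hS hST hle hij hs hiui hiu6 hmE
        hwII' (liouvTypeIICoeffB u) (abs_liouvTypeIICoeffB_le u)
      exact (abs_boxSum_le_of_shortSide T i j (abs_typeIICoeffA_le hB1 u) hF).1
    · have hF := boxII_bound hc hC hII hE1 hρ1 hρE hcρ hs₀E S T hS hST hle (by omega) (by omega)
        hiuj hiu6 hmE hwII' (typeIICoeffA u B) (abs_typeIICoeffA_le hB1 u)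
      exact (abs_boxSum_le_of_shortSide T j i (abs_liouvTypeIICoeffB_le u) hF).2
  have hEI0 : 0 ≤ EI := by positivity
  have hEII0 : 0 ≤ EII := by positivity
  have hcrit := abs_walshSum_liouville_le_of_boxBounds n u B s₀ hB1 A hEI0 hEII0 hI hII'
  exact lt_of_le_of_lt hcrit
    (final_numerics hn1 hC hE1 hpoly hlinE hs₀3 hs₀n hiu4 hudef hB1 hBge hBle)

/-! ### Theorem 1 for `λ` from the per-box type-II bound -/

/-- `e^{-x} ≤ 2^{-x}` for `x ≥ 0`. [folklore] -/
theorem exp_neg_le_two_rpow_neg {x : ℝ} (hx : 0 ≤ x) : Real.exp (-x) ≤ (2 : ℝ) ^ (-x) := by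
  rw [Real.rpow_def_of_pos two_pos, Real.exp_le_exp]
  have h2 : Real.log 2 ≤ 1 := by have := Real.log_two_lt_d9; linarith
  have h0 : 0 ≤ Real.log 2 := Real.log_nonneg one_le_two
  nlinarith

set_option maxHeartbeats 800000 in
/-- **Bourgain 2013, Theorem 1 for the Liouville function, from the per-box TYPE-II bound.**
If the type-II estimate of §2 of the paper holds in the shape `hII` — for every digit set `T`,
every box `D_i × D_j` with `i ≤ j`, every lag exponent `ρ ≥ 1` and every ADMISSIBLE window
start `K` (`K = 0`, or `i ≤ K + ρ`, `4ρ < K`; `K + ρ ≤ j`) and every coefficient `|β| ≤ 1`,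
`∑_{a ∈ D_i} |∑_{b ∈ D_j} β(b) w_T(ab)| ≤ (i+j+2)^C 2^{i+j} (2^{-cρ} + 2^{Cρ - ci} + 2^{Cρ - c|T ∩ [K, K+i)|})`
for some constants `c > 0`, `C ≥ 1` ((2.29)–(2.31) with polynomial losses) — then
`bourgain_liouville_walsh_uniform` holds: small weights `|A| ≤ √n/H`, `H = (2/c_G) n^{1/10}`, by
Green's estimate for `λ` (`liouville_smallWeight`, (2.32)), `A = ∅` by the prime number theorem
for `λ`, and large weights by `walshSum_liouville_largeWeight`; `n₀` collects eight growth
conditions (`log n = o(n^{1/10})`). [cite: Bourgain2013MoebiusWalsh, Theorem 1 (remark on λ), §2 (2.31)–(2.35), §3 (3.10)] -/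
theorem bourgain_liouville_walsh_uniform_of_typeII
    (hII : ∃ c : ℝ, 0 < c ∧ ∃ C : ℝ, 1 ≤ C ∧
      ∀ (T : Finset ℕ) (i j ρ K : ℕ) (β : ℕ → ℝ), i ≤ j → 1 ≤ ρ →
        (K = 0 ∨ (i ≤ K + ρ ∧ 4 * ρ < K)) → K + ρ ≤ j → (∀ b, |β b| ≤ 1) →
        ∑ a ∈ dyBlock i, |∑ b ∈ dyBlock j, β b * natWalsh T (a * b)| ≤
          ((i : ℝ) + j + 2) ^ C * 2 ^ (i + j) *
            ((2 : ℝ) ^ (-(c * ρ)) + (2 : ℝ) ^ (C * ρ - c * i) +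
              (2 : ℝ) ^ (C * ρ - c * ((T.filter fun t => K ≤ t ∧ t < K + i).card : ℝ)))) :
    bourgain_liouville_walsh_uniform := by
  classical
  obtain ⟨c, hc, C, hC, hII⟩ := hII
  obtain ⟨cG, hcG, KG, hKG, hsmall, hempty⟩ := liouville_smallWeight
  have hc₂0 : 0 < walshSupExponent := walshSupExponent_pos
  set A₀ : ℝ := (3 * C / c + C + 3) / c with hA₀
  have hC0 : 0 ≤ C := by linarith
  have hA₀0 : 0 ≤ A₀ := by rw [hA₀]; positivity
  -- eventual facts
  have hev : ∀ᶠ n : ℕ in atTop,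
      Real.logb 2 (8 * n) ≤ (n : ℝ) ^ ((1 : ℝ) / 10) ∧
      384 * (2 : ℝ) ^ (C + 4) * (n : ℝ) ^ (C + 6) ≤ (2 : ℝ) ^ ((1 / 2 : ℝ) * (n : ℝ) ^ ((1 : ℝ) / 10)) ∧
      (60 + 6 * A₀ + 90 / c) * (n : ℝ) ^ ((1 : ℝ) / 10) ≤ (n : ℝ) ^ (1 : ℝ) ∧
      ((2 / cG) * ((18 * A₀ + 42 / c + 38) / walshSupExponent)) * (n : ℝ) ^ ((1 : ℝ) / 5) ≤
        (n : ℝ) ^ ((2 : ℝ) / 5) ∧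
      ((2 / cG) * (12 * A₀ + 18 / c + 30)) * (n : ℝ) ^ ((1 : ℝ) / 10) ≤ (n : ℝ) ^ ((2 : ℝ) / 5) ∧
      (KG * cG / 2 + 1) * (n : ℝ) ^ ((1 : ℝ) / 2) ≤ (2 : ℝ) ^ ((1 : ℝ) * (n : ℝ) ^ ((1 : ℝ) / 10)) ∧
      (4 / cG) * (n : ℝ) ^ ((1 : ℝ) / 10) ≤ (n : ℝ) ^ ((1 : ℝ) / 2) ∧
      (2 * KG + 1) * (n : ℝ) ^ (0 : ℝ) ≤ (2 : ℝ) ^ ((1 : ℝ) * (n : ℝ) ^ ((1 : ℝ) / 10)) := by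
    filter_upwards [eventually_logb_le_rpow_tenth,
      eventually_mul_rpow_le_two_rpow (384 * (2 : ℝ) ^ (C + 4)) (r := C + 6) (by linarith)
        (by norm_num : (0 : ℝ) < 1 / 2),
      eventually_mul_rpow_le_rpow (60 + 6 * A₀ + 90 / c) (by norm_num : (1 : ℝ) / 10 < 1),
      eventually_mul_rpow_le_rpow ((2 / cG) * ((18 * A₀ + 42 / c + 38) / walshSupExponent))
        (by norm_num : (1 : ℝ) / 5 < 2 / 5),
      eventually_mul_rpow_le_rpow ((2 / cG) * (12 * A₀ + 18 / c + 30))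
        (by norm_num : (1 : ℝ) / 10 < 2 / 5),
      eventually_mul_rpow_le_two_rpow (KG * cG / 2 + 1) (r := 1 / 2) (by norm_num) one_pos,
      eventually_mul_rpow_le_rpow (4 / cG) (by norm_num : (1 : ℝ) / 10 < 1 / 2),
      eventually_mul_rpow_le_two_rpow (2 * KG + 1) (r := 0) le_rfl one_pos] with n h1 h2 h3 h4 h5
      h6 h7 h8
    exact ⟨h1, h2, h3, h4, h5, h6, h7, h8⟩
  obtain ⟨n₀, hn₀⟩ := Filter.eventually_atTop.1 hev
  refine ⟨max n₀ 1, fun n hn A => ?_⟩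
  obtain ⟨hF1, hF2, hF3, hF4, hF5, hF6, hF7, hF8⟩ := hn₀ n (le_of_max_le_left hn)
  have hn1 : 1 ≤ n := le_of_max_le_right hn
  have hn0 : (0 : ℝ) < n := by exact_mod_cast hn1
  set E : ℝ := (n : ℝ) ^ ((1 : ℝ) / 10) with hEdef
  have hE1 : 1 ≤ E := Real.one_le_rpow (by exact_mod_cast hn1) (by norm_num)
  have hE0 : 0 ≤ E := by linarith
  have hEpos : 0 < E := by linarith
  -- identities between the powers of `n`
  have hE2 : (n : ℝ) ^ ((1 : ℝ) / 5) = E ^ 2 := by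
    rw [hEdef, ← Real.rpow_natCast, ← Real.rpow_mul hn0.le]; norm_num
  have hsqrt : Real.sqrt n = (n : ℝ) ^ ((1 : ℝ) / 2) := Real.sqrt_eq_rpow n
  have h25 : (n : ℝ) ^ ((2 : ℝ) / 5) = (n : ℝ) ^ ((1 : ℝ) / 2) / E := by
    rw [hEdef, ← Real.rpow_sub hn0]; norm_num
  have h2E : (2 : ℝ) ^ ((1 : ℝ) * E) = (2 : ℝ) ^ E := by rw [one_mul]
  have htarget : (2 : ℝ) ^ ((n : ℝ) - E) = 2 ^ n * (2 : ℝ) ^ (-E) := by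
    rw [sub_eq_add_neg, Real.rpow_add two_pos, Real.rpow_natCast]
  have h2negE0 : 0 < (2 : ℝ) ^ (-E) := by positivity
  have h2neg2 : (2 : ℝ) ^ (-(2 * E)) * (2 : ℝ) ^ E = (2 : ℝ) ^ (-E) := by
    rw [← Real.rpow_add two_pos]; ring_nf
  by_cases hA : A = ∅
  · -- `A = ∅`: the prime number theorem for `λ`
    subst hA
    refine lt_of_le_of_lt (hempty n) ?_
    rw [htarget]
    refine mul_lt_mul_of_pos_left ?_ (by positivity)
    -- `2 KG e^{-(cG/2)√n} < 2^{-E}`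
    have h1 : (cG / 2) * Real.sqrt n ≥ 2 * E := by
      rw [hsqrt]
      have : (4 / cG) * E * (cG / 2) ≤ (n : ℝ) ^ ((1 : ℝ) / 2) * (cG / 2) :=
        mul_le_mul_of_nonneg_right hF7 (by positivity)
      have e : (4 / cG) * E * (cG / 2) = 2 * E := by field_simp; ring
      linarith only [this, e]
    have h2 : Real.exp (-(cG / 2 * Real.sqrt n)) ≤ (2 : ℝ) ^ (-(2 * E)) := by
      calc Real.exp (-(cG / 2 * Real.sqrt n)) ≤ Real.exp (-(2 * E)) :=
            Real.exp_le_exp.2 (by linarith only [h1])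
        _ ≤ (2 : ℝ) ^ (-(2 * E)) := exp_neg_le_two_rpow_neg (by linarith only [hE0])
    have h3 : 2 * KG + 1 ≤ (2 : ℝ) ^ E := by
      rw [Real.rpow_zero, mul_one, h2E] at hF8; exact hF8
    have h4 : 0 < (2 : ℝ) ^ (-(2 * E)) := by positivity
    calc 2 * KG * Real.exp (-(cG / 2 * Real.sqrt n)) ≤ 2 * KG * (2 : ℝ) ^ (-(2 * E)) :=
          mul_le_mul_of_nonneg_left h2 (by positivity)
      _ < (2 * KG + 1) * (2 : ℝ) ^ (-(2 * E)) := by linarith only [h4]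
      _ ≤ (2 : ℝ) ^ E * (2 : ℝ) ^ (-(2 * E)) := mul_le_mul_of_nonneg_right h3 h4.le
      _ = (2 : ℝ) ^ (-E) := by rw [mul_comm, h2neg2]
  · have hAne : A.Nonempty := Finset.nonempty_iff_ne_empty.2 hA
    by_cases hw : (A.card : ℝ) ≤ Real.sqrt n / ((2 / cG) * E)
    · -- small weight: Green's estimate for `λ` (2.32)
      have hH : 0 < (2 / cG) * E := by positivity
      refine lt_of_le_of_lt (hsmall n hn1 ((2 / cG) * E) hH A hAne hw) ?_
      rw [htarget]
      refine mul_lt_mul_of_pos_left ?_ (by positivity)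
      have e1 : cG * ((2 / cG) * E) = 2 * E := by field_simp
      rw [e1]
      have h1 : Real.sqrt n / ((2 / cG) * E) ≤ (cG / 2) * (n : ℝ) ^ ((1 : ℝ) / 2) := by
        rw [hsqrt, div_le_iff₀ hH]
        have h0 : 0 ≤ (n : ℝ) ^ ((1 : ℝ) / 2) := by positivity
        have : (n : ℝ) ^ ((1 : ℝ) / 2) * 1 ≤ (n : ℝ) ^ ((1 : ℝ) / 2) * E :=
          mul_le_mul_of_nonneg_left hE1 h0
        have e : (cG / 2) * (n : ℝ) ^ ((1 : ℝ) / 2) * ((2 / cG) * E) = (n : ℝ) ^ ((1 : ℝ) / 2) * E := by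
          field_simp
        linarith only [this, e]
      have h2 : Real.exp (-(2 * E)) ≤ (2 : ℝ) ^ (-(2 * E)) :=
        exp_neg_le_two_rpow_neg (by linarith only [hE0])
      have h3 : (KG * cG / 2 + 1) * (n : ℝ) ^ ((1 : ℝ) / 2) ≤ (2 : ℝ) ^ E := by rw [h2E] at hF6; exact hF6
      have h4 : 0 < (2 : ℝ) ^ (-(2 * E)) := by positivity
      have hn12 : 0 < (n : ℝ) ^ ((1 : ℝ) / 2) := by positivity
      calc KG * (Real.sqrt n / ((2 / cG) * E)) * Real.exp (-(2 * E))
          ≤ KG * ((cG / 2) * (n : ℝ) ^ ((1 : ℝ) / 2)) * (2 : ℝ) ^ (-(2 * E)) :=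
            mul_le_mul (mul_le_mul_of_nonneg_left h1 hKG) h2 (by positivity) (by positivity)
        _ = (KG * cG / 2) * (n : ℝ) ^ ((1 : ℝ) / 2) * (2 : ℝ) ^ (-(2 * E)) := by ring
        _ < (KG * cG / 2 + 1) * (n : ℝ) ^ ((1 : ℝ) / 2) * (2 : ℝ) ^ (-(2 * E)) := by
            have : (KG * cG / 2) * (n : ℝ) ^ ((1 : ℝ) / 2) < (KG * cG / 2 + 1) * (n : ℝ) ^ ((1 : ℝ) / 2) := by
              linarith only [hn12]
            exact mul_lt_mul_of_pos_right this h4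
        _ ≤ (2 : ℝ) ^ E * (2 : ℝ) ^ (-(2 * E)) := mul_le_mul_of_nonneg_right h3 h4.le
        _ = (2 : ℝ) ^ (-E) := by rw [mul_comm, h2neg2]
    · -- large weight
      have hw' : Real.sqrt n / ((2 / cG) * E) < A.card := lt_of_not_ge hw
      have hwE : (cG / 2) * (n : ℝ) ^ ((2 : ℝ) / 5) < A.card := by
        have e : Real.sqrt n / ((2 / cG) * E) = (cG / 2) * (n : ℝ) ^ ((2 : ℝ) / 5) := by
          rw [hsqrt, h25]; field_simp
        rwa [e] at hw'
      have hF3' : (60 + 6 * A₀ + 90 / c) * E ≤ n := by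
        have := hF3; rwa [Real.rpow_one] at this
      refine walshSum_liouville_largeWeight hc hC hII hn1 hF1 hF2 hF3' A ?_ ?_
      · -- the quadratic weight condition
        have h1 : ((18 * A₀ + 42 / c + 38) / walshSupExponent) * E ^ 2 < A.card := by
          have := mul_le_mul_of_nonneg_left hF4 (show (0 : ℝ) ≤ cG / 2 by positivity)
          have e : cG / 2 * (2 / cG * ((18 * A₀ + 42 / c + 38) / walshSupExponent) * (n : ℝ) ^ ((1 : ℝ) / 5)) =
              ((18 * A₀ + 42 / c + 38) / walshSupExponent) * E ^ 2 := by
            rw [hE2]; field_simp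
          linarith only [this, e, hwE]
        have h2 : (18 * A₀ + 42 / c + 38) * E ^ 2 < walshSupExponent * A.card := by
          have := mul_lt_mul_of_pos_left h1 hc₂0
          have e : walshSupExponent * (((18 * A₀ + 42 / c + 38) / walshSupExponent) * E ^ 2) =
              (18 * A₀ + 42 / c + 38) * E ^ 2 := by field_simp
          linarith only [this, e]
        have hEE : E ≤ E ^ 2 := by
          calc E = E * 1 := (mul_one E).symm
            _ ≤ E * E := mul_le_mul_of_nonneg_left hE1 hE0
            _ = E ^ 2 := (sq E).symm
        have e3 : (16 * (A₀ * E) + 12 * (E / c) + 16 * E) * E + 2 * (A₀ * E) + 30 * (E / c) + 22 * E =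
            (16 * A₀ + 12 / c + 16) * E ^ 2 + (2 * A₀ + 30 / c + 22) * E := by ring
        have e4 : (18 * A₀ + 42 / c + 38) * E ^ 2 =
            (16 * A₀ + 12 / c + 16) * E ^ 2 + (2 * A₀ + 30 / c + 22) * E ^ 2 := by ring
        have hcoef : 0 ≤ 2 * A₀ + 30 / c + 22 := by positivity
        have h5 : (2 * A₀ + 30 / c + 22) * E ≤ (2 * A₀ + 30 / c + 22) * E ^ 2 :=
          mul_le_mul_of_nonneg_left hEE hcoef
        show (16 * (A₀ * E) + 12 * (E / c) + 16 * E) * E + 2 * (A₀ * E) + 30 * (E / c) + 22 * E ≤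
          walshSupExponent * A.card
        linarith only [h2, e3, e4, h5]
      · -- the linear weight condition
        have h1 : (12 * A₀ + 18 / c + 30) * E < A.card := by
          have := mul_le_mul_of_nonneg_left hF5 (show (0 : ℝ) ≤ cG / 2 by positivity)
          have e : cG / 2 * (2 / cG * (12 * A₀ + 18 / c + 30) * E) =
              (12 * A₀ + 18 / c + 30) * E := by
            field_simp
          linarith only [this, e, hwE]
        have e2 : 12 * (A₀ * E) + 18 * (E / c) + 30 * E = (12 * A₀ + 18 / c + 30) * E := by ring
        show 12 * (A₀ * E) + 18 * (E / c) + 30 * E ≤ A.card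
        linarith only [h1, e2]

end Literature.NumberTheory.LFunctions.LiouvilleWalsh
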